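import Literature.Computability.AlgebraicComplexity.MW21SingularTuplesNullCone
import Literature.Computability.AlgebraicComplexity.MW21SingMaximalSubspaces
import Literature.NumberTheory.DiophantineGeometry.DetStabilizerFrobeniusProofs
import Mathlib.LinearAlgebra.Basis.VectorSpace
import HarnessLib

/-!
# Linear maps of `Mat_n^m` permuting the kernel families `ℂ^m ⊗ K_v`, `ℂ^m ⊗ K^w` lie in
# `G_{n,m} ∪ G_{n,m}·τ` (the preserver core of Makam–Wigderson 2021, Thms. 1.13 / 1.14)

Sibling proof file of `Literature/Computability/AlgebraicComplexity/MW21SingularTuplesNullCone.lean`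
(cell `val-lit`, cross-ladder typing row X3-MW21; V. Makam, A. Wigderson, *Singular tuples of
matrices is not a null cone (and the symmetries of algebraic varieties)*, J. reine angew. Math.
**780** (2021) = arXiv:1909.00857, Thms. 1.13, 1.14, p0006:L33–40).  It proves the linear-algebra
core of an elementary (preserver-style) route to the hard inclusion `𝒢_S ⊆ G_{n,m} ⋊ ⟨τ⟩` of those
theorems, DIFFERENT from the printed proof (MW §9 computes the Lie algebra of `𝒢_S`; Mathlib has no
algebraic-group/Lie-algebra correspondence).  For `v ≠ 0` write `M_v = {X ∈ Mat_n^m | Xᵢ v = 0 ∀ i}`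
(`= ℂ^m ⊗ K_v`) and `M^w = {X | wᵀ Xᵢ = 0 ∀ i}` (`= ℂ^m ⊗ K^w`).

**Theorem** (`MakamWigderson.mem_G_or_mul_tau_mem_G_of_image_kernelSpaces`).  Let `n ≥ 2`, `m ≥ 1`
and let `g ∈ GL(Mat_n^m)` be such that `g` and `g⁻¹` map every `M_v` and every `M^w` onto some
`M_{v'}` or some `M^{w'}`.  Then `g ∈ G_{n,m}` or `g·τ ∈ G_{n,m}`.

In the intended application (`S = SING_{n,m}` or `NSING_{n,m}`) the hypothesis is supplied by the
classification of the linear subspaces of `S` of the maximal dimension `m·n(n-1)` (Dieudonné 1949 /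
Flanders 1962 for `m = 1`), which is NOT part of this file.

## Proof (all steps proved here; no dimension counts are used)

1. *Family separation.*  For independent `v₁, v₂` the intersection `M_{v₁} ∩ M_{v₂}` lies in the
   three distinct members `M_{v₁}, M_{v₂}, M_{v₁+v₂}`, whereas an intersection `M_{v'} ∩ M^{w'}`
   lies in exactly two members; comparing through `g` (and `g⁻¹`) shows that `g` maps the two
   families to the two families, preserving or swapping them; in the swapping case pass to `g·τ`.
2. *Hyperplanes.*  With `M_P = {X | Xᵢ p = 0 ∀ p ∈ P}` and `rk(𝓧) = {p | Xᵢ p = 0 ∀ X ∈ 𝓧}` one has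
   `rk(M_P) = P` and `g(M_P) = M_{rk(g M_P)}`; applied to the hyperplane `P = b^⊥` and to `g⁻¹`,
   together with `Submodule.exists_le_ker_of_lt_top` and the maximality of `b^⊥`, this gives
   `g(M_{b^⊥}) = M_{b'^⊥}` for some `b' ≠ 0`, and dually for rows.
3. *Rank-one tuples.*  `{c ⊗ a bᵀ} = M_{b^⊥} ∩ M^{a^⊥}`, so `g(c ⊗ a bᵀ) = L_{a,b}(c) ⊗ a' b'ᵀ` with
   `a'` depending on `a` only and `b'` on `b` only; comparing `a₁, a₂, a₁ + a₂` with separating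
   vectors (`MarcusMoyls.exists_dotProduct_separating`) gives `L_{a,b} = t·L₀`.
4. *Slices.*  `H(A) :=` a fixed slice of `g(e₀ ⊗ A)` is a linear bijection of `Mat_n` with
   `g(c ⊗ A) = L₀(c) ⊗ H(A)`, mapping rank-`≤ 1` matrices to rank-`≤ 1` matrices in both directions
   (the backward direction from the same analysis of `g⁻¹`); the tree's Marcus–Moyls engine
   `MarcusMoyls.exists_sandwich_or_transpose_sandwich` gives `H(X) = U X V` or `U Xᵀ V`, whence
   `g = tripleAct P U Vᵀ` or `g = tripleAct P U Vᵀ ∘ τ`, with `P, U, V` invertible.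

Honest framing: classical linear preserver bookkeeping for a 2021 theorem's symmetry-group
computation; nothing here bears on VP versus VNP.  No definitions, no new facts.

## References

* [MakamWigderson2021] V. Makam, A. Wigderson, J. reine angew. Math. 780 (2021) =
  arXiv:1909.00857, Thm. 1.13 (p0006:L33), Thm. 1.14 (p0006:L40), §9.
* J. Dieudonné, *Sur une généralisation du groupe orthogonal à quatre variables*, Arch. Math. 1
  (1949) 282–287; M. Marcus, B. N. Moyls, *Linear transformations on algebras of matrices*,
  Canad. J. Math. 11 (1959) 61–66 (the tree's engine `MarcusMoyls.*`).
-/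

noncomputable section

open Matrix

namespace Literature.Computability.AlgebraicComplexity

namespace MakamWigderson

open Literature.NumberTheory.DiophantineGeometry

namespace KernelFamily

variable {n m : ℕ}

/-! ### Vectors and rank-one matrices -/

/-- `wᵀ (u zᵀ) = (w ⬝ u) zᵀ`. [cite: MakamWigderson2021, Thm. 1.13 (proof, elementary route)] -/
theorem vecMul_vecMulVec_eq_smul (w u z : Fin n → ℂ) :
    w ᵥ* vecMulVec u z = (w ⬝ᵥ u) • z := by
  ext j
  simp only [vecMul, dotProduct, vecMulVec_apply, Pi.smul_apply, smul_eq_mul, Finset.sum_mul]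
  exact Finset.sum_congr rfl fun i _ => by ring

/-- A nonzero vector has a nonzero coordinate. [folklore] -/
private theorem exists_apply_ne_zero {v : Fin n → ℂ} (hv : v ≠ 0) : ∃ j, v j ≠ 0 := by
  by_contra! h
  exact hv (funext h)

/-- For `v ≠ 0` there is `u` with `v ⬝ u ≠ 0`. [folklore] -/
private theorem exists_dotProduct_ne_zero {v : Fin n → ℂ} (hv : v ≠ 0) : ∃ u : Fin n → ℂ, v ⬝ᵥ u ≠ 0 := by
  obtain ⟨j, hj⟩ := exists_apply_ne_zero hv
  exact ⟨Pi.single j 1, by rwa [dotProduct_single, mul_one]⟩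

/-- In dimension `n ≥ 2` every vector has a nonzero orthogonal vector (for the bilinear dot
product). [folklore] -/
private theorem exists_ne_zero_dotProduct_eq_zero (hn : 2 ≤ n) (v : Fin n → ℂ) :
    ∃ z : Fin n → ℂ, z ≠ 0 ∧ z ⬝ᵥ v = 0 := by
  set i0 : Fin n := ⟨0, by omega⟩
  set i1 : Fin n := ⟨1, by omega⟩
  have h01 : i0 ≠ i1 := by simp [i0, i1, Fin.ext_iff]
  by_cases h0 : v i0 = 0
  · refine ⟨Pi.single i0 1, ?_, ?_⟩
    · intro h
      have := congr_fun h i0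
      simp at this
    · rw [single_dotProduct, one_mul, h0]
  · refine ⟨v i1 • Pi.single i0 1 - v i0 • Pi.single i1 1, ?_, ?_⟩
    · intro h
      have := congr_fun h i1
      simp only [Pi.sub_apply, Pi.smul_apply, Pi.single_apply, h01.symm, if_false, if_true,
        smul_eq_mul, mul_zero, mul_one, zero_sub, Pi.zero_apply, neg_eq_zero] at this
      exact h0 this
    · simp only [sub_dotProduct, smul_dotProduct, single_dotProduct, one_mul, smul_eq_mul]
      ring

/-- Vectors orthogonal to everything orthogonal to `u ≠ 0` are multiples of `u`. [folklore] -/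
private theorem exists_eq_smul_of_forall_dotProduct {u v : Fin n → ℂ} (hu : u ≠ 0)
    (h : ∀ x : Fin n → ℂ, u ⬝ᵥ x = 0 → v ⬝ᵥ x = 0) : ∃ c : ℂ, v = c • u := by
  by_contra! hne
  obtain ⟨x, y, -, -, huy, hvy⟩ := MarcusMoyls.exists_dotProduct_separating hu hne
  have := h y huy
  rw [hvy] at this
  exact one_ne_zero this

/-- A matrix killing the hyperplane `b^⊥` (`b ≠ 0`) is an outer product `u bᵀ`. [folklore] -/
private theorem exists_eq_vecMulVec_of_mulVec_eq_zero {b : Fin n → ℂ} (hb : b ≠ 0)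
    {A : Matrix (Fin n) (Fin n) ℂ} (hA : ∀ p : Fin n → ℂ, b ⬝ᵥ p = 0 → A *ᵥ p = 0) :
    ∃ u : Fin n → ℂ, A = vecMulVec u b := by
  obtain ⟨j, hj⟩ := exists_apply_ne_zero hb
  refine ⟨(b j)⁻¹ • A *ᵥ Pi.single j 1, ?_⟩
  have key : ∀ p : Fin n → ℂ, A *ᵥ p = vecMulVec ((b j)⁻¹ • A *ᵥ Pi.single j 1) b *ᵥ p := by
    intro p
    have hp : b ⬝ᵥ (p - ((b j)⁻¹ * (b ⬝ᵥ p)) • Pi.single j 1) = 0 := by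
      rw [dotProduct_sub, dotProduct_smul, dotProduct_single, mul_one, smul_eq_mul]
      field_simp
      ring
    have h1 := hA _ hp
    rw [mulVec_sub, mulVec_smul, sub_eq_zero] at h1
    rw [h1, MarcusMoyls.vecMulVec_mulVec_eq_smul, smul_smul]
    congr 1
    exact mul_comm _ _
  ext a c
  have := congr_fun (key (Pi.single c 1)) a
  simpa [mulVec_single_one] using this

/-- **Rank-one tuples through kernels.**  For `a, b ≠ 0`, a tuple `X` all of whose components kill
the hyperplane `b^⊥` on the right and `a^⊥` on the left is `c ⊗ a bᵀ`.
[cite: MakamWigderson2021, Thm. 1.13 (proof, elementary route)] -/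
theorem exists_eq_smul_vecMulVec {a b : Fin n → ℂ} (ha : a ≠ 0) (hb : b ≠ 0) {X : Tuple n m}
    (hcol : ∀ p : Fin n → ℂ, b ⬝ᵥ p = 0 → ∀ i, X i *ᵥ p = 0)
    (hrow : ∀ q : Fin n → ℂ, a ⬝ᵥ q = 0 → ∀ i, q ᵥ* X i = 0) :
    ∃ c : Fin m → ℂ, X = fun i => c i • vecMulVec a b := by
  have hu : ∀ i, ∃ u : Fin n → ℂ, X i = vecMulVec u b := fun i =>
    exists_eq_vecMulVec_of_mulVec_eq_zero hb fun p hp => hcol p hp i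
  choose u hu using hu
  have hc : ∀ i, ∃ c : ℂ, u i = c • a := by
    intro i
    refine exists_eq_smul_of_forall_dotProduct ha fun q hq => ?_
    obtain ⟨p, hp⟩ := exists_dotProduct_ne_zero hb
    have h1 := hrow q hq i
    rw [hu i, vecMul_vecMulVec_eq_smul] at h1
    have h2 := congr_arg (fun z => z ⬝ᵥ p) h1
    simp only [smul_dotProduct, zero_dotProduct, smul_eq_mul, mul_eq_zero] at h2
    rcases h2 with h2 | h2
    · rwa [dotProduct_comm]
    · exact absurd h2 hp
  choose c hc using hc
  refine ⟨c, funext fun i => ?_⟩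
  rw [hu i, hc i, smul_vecMulVec]

/-- Conversely the components of `c ⊗ a bᵀ` kill `b^⊥` on the right …
[cite: MakamWigderson2021, Thm. 1.13 (proof, elementary route)] -/
theorem smul_vecMulVec_mulVec_eq_zero (c : Fin m → ℂ) (a : Fin n → ℂ) {b p : Fin n → ℂ}
    (hp : b ⬝ᵥ p = 0) (i : Fin m) : (c i • vecMulVec a b) *ᵥ p = 0 := by
  rw [smul_mulVec, MarcusMoyls.vecMulVec_mulVec_eq_smul, hp, zero_smul, smul_zero]

/-- … and `a^⊥` on the left. [cite: MakamWigderson2021, Thm. 1.13 (proof, elementary route)] -/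
theorem vecMul_smul_vecMulVec_eq_zero (c : Fin m → ℂ) {a q : Fin n → ℂ} (b : Fin n → ℂ)
    (hq : a ⬝ᵥ q = 0) (i : Fin m) : q ᵥ* (c i • vecMulVec a b) = 0 := by
  rw [vecMul_smul, vecMul_vecMulVec_eq_smul, dotProduct_comm, hq, zero_smul, smul_zero]

/-- `d ⊗ A = d' ⊗ A` with `A ≠ 0` forces `d = d'`. [folklore] -/
private theorem smul_left_cancel {d d' : Fin m → ℂ} {A : Matrix (Fin n) (Fin n) ℂ} (hA : A ≠ 0)
    (h : (fun i => d i • A) = fun i => d' i • A) : d = d' := by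
  funext i
  have hi : d i • A = d' i • A := congr_fun h i
  rw [← sub_eq_zero, ← sub_smul, smul_eq_zero] at hi
  rcases hi with hi | hi
  · exact sub_eq_zero.mp hi
  · exact absurd hi hA

/-- `c ⊗ A = 0` with `A ≠ 0` forces `c = 0`. [folklore] -/
private theorem eq_zero_of_smul_eq_zero {c : Fin m → ℂ} {A : Matrix (Fin n) (Fin n) ℂ} (hA : A ≠ 0)
    (h : (fun i => c i • A) = 0) : c = 0 := by
  refine smul_left_cancel hA ?_
  rw [h]
  funext i
  simp

/-! ### The kernel families: witnesses -/

/-- `M_v ⊆ M_u` forces `u ∈ ℂ v` (`v ≠ 0`, `m ≥ 1`).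
[cite: MakamWigderson2021, Thm. 1.13 (proof, elementary route)] -/
theorem exists_eq_smul_of_col_subset_col (hn : 2 ≤ n) (hm : 1 ≤ m) {v u : Fin n → ℂ} (hv : v ≠ 0)
    (h : ∀ X : Tuple n m, (∀ i, X i *ᵥ v = 0) → ∀ i, X i *ᵥ u = 0) : ∃ s : ℂ, u = s • v := by
  by_contra! hne
  obtain ⟨x, y, -, -, hvy, huy⟩ := MarcusMoyls.exists_dotProduct_separating hv hne
  obtain ⟨t, ht, -⟩ := exists_ne_zero_dotProduct_eq_zero hn 0
  have h1 := h (fun _ => vecMulVec t y) (fun i => by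
    rw [MarcusMoyls.vecMulVec_mulVec_eq_smul, dotProduct_comm, hvy, zero_smul]) ⟨0, hm⟩
  rw [MarcusMoyls.vecMulVec_mulVec_eq_smul, dotProduct_comm, huy, one_smul] at h1
  exact ht h1

/-- `M^w ⊆ M^u` forces `u ∈ ℂ w`. [cite: MakamWigderson2021, Thm. 1.13 (proof, elementary route)] -/
theorem exists_eq_smul_of_row_subset_row (hn : 2 ≤ n) (hm : 1 ≤ m) {w u : Fin n → ℂ} (hw : w ≠ 0)
    (h : ∀ X : Tuple n m, (∀ i, w ᵥ* X i = 0) → ∀ i, u ᵥ* X i = 0) : ∃ s : ℂ, u = s • w := by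
  by_contra! hne
  obtain ⟨x, y, -, -, hwy, huy⟩ := MarcusMoyls.exists_dotProduct_separating hw hne
  obtain ⟨t, ht, -⟩ := exists_ne_zero_dotProduct_eq_zero hn 0
  have h1 := h (fun _ => vecMulVec y t) (fun i => by
    rw [vecMul_vecMulVec_eq_smul, hwy, zero_smul]) ⟨0, hm⟩
  rw [vecMul_vecMulVec_eq_smul, huy, one_smul] at h1
  exact ht h1

/-- `M_v ≠ M^w`: some tuple kills `v` on the right but not `w` on the left (`n ≥ 2`).
[cite: MakamWigderson2021, Thm. 1.13 (proof, elementary route)] -/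
theorem not_col_iff_row (hn : 2 ≤ n) (hm : 1 ≤ m) {v w : Fin n → ℂ} (hw : w ≠ 0)
    (h : ∀ X : Tuple n m, (∀ i, X i *ᵥ v = 0) ↔ ∀ i, w ᵥ* X i = 0) : False := by
  obtain ⟨z, hz, hzv⟩ := exists_ne_zero_dotProduct_eq_zero hn v
  obtain ⟨u, hu⟩ := exists_dotProduct_ne_zero hw
  have h1 := (h fun _ => vecMulVec u z).mp (fun i => by
    rw [MarcusMoyls.vecMulVec_mulVec_eq_smul, hzv, zero_smul]) ⟨0, hm⟩
  rw [vecMul_vecMulVec_eq_smul, smul_eq_zero] at h1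
  rcases h1 with h1 | h1
  · exact hu h1
  · exact hz h1

/-- `M_{v'} ∩ M^{w'} ⊆ M_u` forces `u ∈ ℂ v'` (`n ≥ 2`).
[cite: MakamWigderson2021, Thm. 1.13 (proof, elementary route)] -/
theorem exists_eq_smul_of_col_inter_row_subset_col (hn : 2 ≤ n) (hm : 1 ≤ m) {v' w' u : Fin n → ℂ}
    (hv' : v' ≠ 0)
    (h : ∀ X : Tuple n m, (∀ i, X i *ᵥ v' = 0) → (∀ i, w' ᵥ* X i = 0) → ∀ i, X i *ᵥ u = 0) :
    ∃ s : ℂ, u = s • v' := by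
  by_contra! hne
  obtain ⟨x, y, -, -, hvy, huy⟩ := MarcusMoyls.exists_dotProduct_separating hv' hne
  obtain ⟨t, ht, htw⟩ := exists_ne_zero_dotProduct_eq_zero hn w'
  have h1 := h (fun _ => vecMulVec t y)
    (fun i => by rw [MarcusMoyls.vecMulVec_mulVec_eq_smul, dotProduct_comm, hvy, zero_smul])
    (fun i => by rw [vecMul_vecMulVec_eq_smul, dotProduct_comm, htw, zero_smul]) ⟨0, hm⟩
  rw [MarcusMoyls.vecMulVec_mulVec_eq_smul, dotProduct_comm, huy, one_smul] at h1
  exact ht h1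

/-- `M_{v'} ∩ M^{w'} ⊆ M^u` forces `u ∈ ℂ w'` (`n ≥ 2`).
[cite: MakamWigderson2021, Thm. 1.13 (proof, elementary route)] -/
theorem exists_eq_smul_of_col_inter_row_subset_row (hn : 2 ≤ n) (hm : 1 ≤ m) {v' w' u : Fin n → ℂ}
    (hw' : w' ≠ 0)
    (h : ∀ X : Tuple n m, (∀ i, X i *ᵥ v' = 0) → (∀ i, w' ᵥ* X i = 0) → ∀ i, u ᵥ* X i = 0) :
    ∃ s : ℂ, u = s • w' := by
  by_contra! hne
  obtain ⟨x, y, -, -, hwy, huy⟩ := MarcusMoyls.exists_dotProduct_separating hw' hne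
  obtain ⟨t, ht, htv⟩ := exists_ne_zero_dotProduct_eq_zero hn v'
  have h1 := h (fun _ => vecMulVec y t)
    (fun i => by rw [MarcusMoyls.vecMulVec_mulVec_eq_smul, htv, zero_smul])
    (fun i => by rw [vecMul_vecMulVec_eq_smul, hwy, zero_smul]) ⟨0, hm⟩
  rw [vecMul_vecMulVec_eq_smul, huy, one_smul] at h1
  exact ht h1

/-- Proportional nonzero vectors have the same right kernel family member. [folklore] -/
private theorem col_iff_col_of_eq_smul {v u : Fin n → ℂ} {s : ℂ} (hs : s ≠ 0) (hu : u = s • v)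
    (X : Tuple n m) : (∀ i, X i *ᵥ u = 0) ↔ ∀ i, X i *ᵥ v = 0 := by
  subst hu
  simp only [mulVec_smul, smul_eq_zero, hs, false_or]

/-- Proportional nonzero vectors have the same left kernel family member. [folklore] -/
private theorem row_iff_row_of_eq_smul {w u : Fin n → ℂ} {s : ℂ} (hs : s ≠ 0) (hu : u = s • w)
    (X : Tuple n m) : (∀ i, u ᵥ* X i = 0) ↔ ∀ i, w ᵥ* X i = 0 := by
  subst hu
  simp only [smul_vecMul, smul_eq_zero, hs, false_or]

/-- `A = 0` iff `A v = 0` for all `v`. [folklore] -/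
private theorem eq_zero_of_forall_mulVec_eq_zero {A : Matrix (Fin n) (Fin n) ℂ} (h : ∀ v, A *ᵥ v = 0) :
    A = 0 :=
  ext_iff_mulVec.mpr fun v => by rw [h, zero_mulVec]

/-! ### Hyperplanes go to hyperplanes -/

/-- **Images of right-kernel spaces.**  If `γ` maps every `M_v` onto some `M_{v'}`, then for every
set of vectors `P` the image `γ(M_P)`, `M_P = {X | Xᵢ p = 0 ∀ p ∈ P, ∀ i}`, is cut out by its own
right kernel `{q | Yᵢ q = 0 ∀ Y ∈ γ(M_P)}`. [cite: MakamWigderson2021, Thm. 1.13 (proof, elementary route)] -/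
theorem image_kernelSpace_iff (γ : Tuple n m ≃ₗ[ℂ] Tuple n m)
    (hc : ∀ v : Fin n → ℂ, v ≠ 0 → ∃ v' : Fin n → ℂ, v' ≠ 0 ∧
      ∀ X : Tuple n m, (∀ i, γ X i *ᵥ v' = 0) ↔ ∀ i, X i *ᵥ v = 0)
    (P : (Fin n → ℂ) → Prop) (X : Tuple n m) :
    (∀ q : Fin n → ℂ, (∀ Z : Tuple n m, (∀ p, P p → ∀ i, Z i *ᵥ p = 0) → ∀ i, γ Z i *ᵥ q = 0) →
      ∀ i, γ X i *ᵥ q = 0) ↔ ∀ p, P p → ∀ i, X i *ᵥ p = 0 := by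
  constructor
  · intro h p hp i
    by_cases hp0 : p = 0
    · rw [hp0, mulVec_zero]
    obtain ⟨p', -, hiff⟩ := hc p hp0
    have hmem : ∀ Z : Tuple n m, (∀ p, P p → ∀ i, Z i *ᵥ p = 0) → ∀ i, γ Z i *ᵥ p' = 0 :=
      fun Z hZ => (hiff Z).mpr fun i => hZ p hp i
    exact (hiff X).mp (h p' hmem) i
  · intro hX q hq
    exact hq X hX

/-- **Hyperplanes to hyperplanes (right kernels).**  If `γ` and `γ⁻¹` map every `M_v` onto some
`M_{v'}`, then for every `b ≠ 0` there is `b' ≠ 0` with `γ(M_{b^⊥}) = M_{b'^⊥}`, where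
`M_{b^⊥} = {X | Xᵢ p = 0 whenever b ⬝ p = 0}` (no dimension count: the right kernel of
`γ(M_{b^⊥})` is a proper subspace, hence inside a hyperplane `b'^⊥` by
`Submodule.exists_le_ker_of_lt_top`, and the same for `γ⁻¹` and `b'` lands inside a proper
subspace containing the maximal `b^⊥`). [cite: MakamWigderson2021, Thm. 1.13 (proof, elementary route)] -/
theorem exists_colHyperplane (hn : 2 ≤ n) (hm : 1 ≤ m) (γ : Tuple n m ≃ₗ[ℂ] Tuple n m)
    (hc : ∀ v : Fin n → ℂ, v ≠ 0 → ∃ v' : Fin n → ℂ, v' ≠ 0 ∧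
      ∀ X : Tuple n m, (∀ i, γ X i *ᵥ v' = 0) ↔ ∀ i, X i *ᵥ v = 0)
    (hc' : ∀ v : Fin n → ℂ, v ≠ 0 → ∃ v' : Fin n → ℂ, v' ≠ 0 ∧
      ∀ X : Tuple n m, (∀ i, γ.symm X i *ᵥ v' = 0) ↔ ∀ i, X i *ᵥ v = 0)
    {b : Fin n → ℂ} (hb : b ≠ 0) :
    ∃ b' : Fin n → ℂ, b' ≠ 0 ∧ ∀ X : Tuple n m,
      (∀ p, b' ⬝ᵥ p = 0 → ∀ i, γ X i *ᵥ p = 0) ↔ ∀ p, b ⬝ᵥ p = 0 → ∀ i, X i *ᵥ p = 0 := by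
  have i0 : Fin m := ⟨0, hm⟩
  obtain ⟨t, ht, -⟩ := exists_ne_zero_dotProduct_eq_zero hn 0
  -- the right kernel `Q` of `γ(M_{b^⊥})`
  let Q : Submodule ℂ (Fin n → ℂ) :=
    { carrier := {q | ∀ Z : Tuple n m, (∀ p, b ⬝ᵥ p = 0 → ∀ i, Z i *ᵥ p = 0) → ∀ i, γ Z i *ᵥ q = 0}
      add_mem' := fun {q₁ q₂} h₁ h₂ Z hZ i => by
        rw [mulVec_add, h₁ Z hZ i, h₂ Z hZ i, add_zero]
      zero_mem' := fun Z _ i => mulVec_zero _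
      smul_mem' := fun c q hq Z hZ i => by
        rw [mulVec_smul, hq Z hZ i, smul_zero] }
  have hQX : ∀ X : Tuple n m, (∀ q, q ∈ Q → ∀ i, γ X i *ᵥ q = 0) ↔
      ∀ p, b ⬝ᵥ p = 0 → ∀ i, X i *ᵥ p = 0 :=
    fun X => image_kernelSpace_iff γ hc (fun p => b ⬝ᵥ p = 0) X
  -- `Q` is a proper subspace
  have hX0 : ∀ p, b ⬝ᵥ p = 0 → ∀ i : Fin m, (fun _ : Fin m => vecMulVec t b) i *ᵥ p = 0 :=
    fun p hp i => by rw [MarcusMoyls.vecMulVec_mulVec_eq_smul, hp, zero_smul]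
  have hQtop : Q < ⊤ := by
    rw [lt_top_iff_ne_top]
    intro htop
    have h1 : ∀ q, ∀ i, γ (fun _ : Fin m => vecMulVec t b) i *ᵥ q = 0 :=
      fun q => (hQX _).mpr hX0 q (by rw [htop]; exact Submodule.mem_top)
    have h2 : γ (fun _ : Fin m => vecMulVec t b) = 0 :=
      funext fun i => eq_zero_of_forall_mulVec_eq_zero fun q => h1 q i
    have h3 : (fun _ : Fin m => vecMulVec t b) = 0 :=
      γ.injective (by rw [h2, map_zero])
    have h4 := congr_fun h3 i0
    simp only [Pi.zero_apply, vecMulVec_eq_zero] at h4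
    rcases h4 with h4 | h4
    · exact ht h4
    · exact hb h4
  obtain ⟨f, hf0, hQf⟩ := Submodule.exists_le_ker_of_lt_top Q hQtop
  -- the functional `f` is `q ↦ z ⬝ q`
  set z : Fin n → ℂ := fun j => f fun k => if j = k then 1 else 0 with hz
  have hfz : ∀ q, f q = z ⬝ᵥ q := by
    intro q
    rw [LinearMap.pi_apply_eq_sum_univ f q, dotProduct]
    exact Finset.sum_congr rfl fun j _ => by rw [smul_eq_mul, mul_comm]
  have hz0 : z ≠ 0 := by
    intro h0
    apply hf0
    apply LinearMap.ext
    intro q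
    rw [hfz, h0, zero_dotProduct, LinearMap.zero_apply]
  have hQz : ∀ q, q ∈ Q → z ⬝ᵥ q = 0 := fun q hq => by
    rw [← hfz]
    exact hQf hq
  -- the same for `γ⁻¹` and `z`
  have hQ'X : ∀ Y : Tuple n m,
      (∀ q, (∀ Z : Tuple n m, (∀ p, z ⬝ᵥ p = 0 → ∀ i, Z i *ᵥ p = 0) → ∀ i, γ.symm Z i *ᵥ q = 0) →
        ∀ i, γ.symm Y i *ᵥ q = 0) ↔ ∀ p, z ⬝ᵥ p = 0 → ∀ i, Y i *ᵥ p = 0 :=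
    fun Y => image_kernelSpace_iff γ.symm hc' (fun p => z ⬝ᵥ p = 0) Y
  -- `b^⊥` lies in the right kernel `Q'` of `γ⁻¹(M_{z^⊥})`
  have hbQ' : ∀ x, b ⬝ᵥ x = 0 → ∀ Z : Tuple n m, (∀ p, z ⬝ᵥ p = 0 → ∀ i, Z i *ᵥ p = 0) →
      ∀ i, γ.symm Z i *ᵥ x = 0 := by
    intro x hx Z hZ
    have h1 : ∀ q, q ∈ Q → ∀ i, γ (γ.symm Z) i *ᵥ q = 0 := fun q hq i => by
      rw [LinearEquiv.apply_symm_apply]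
      exact hZ q (hQz q hq) i
    exact (hQX _).mp h1 x hx
  -- `Q'` is a proper subspace
  have hQ'top : ¬ ∀ x, ∀ Z : Tuple n m, (∀ p, z ⬝ᵥ p = 0 → ∀ i, Z i *ᵥ p = 0) →
      ∀ i, γ.symm Z i *ᵥ x = 0 := by
    intro htop
    have hZ0 : ∀ p, z ⬝ᵥ p = 0 → ∀ i : Fin m, (fun _ : Fin m => vecMulVec t z) i *ᵥ p = 0 :=
      fun p hp i => by rw [MarcusMoyls.vecMulVec_mulVec_eq_smul, hp, zero_smul]
    have h2 : γ.symm (fun _ : Fin m => vecMulVec t z) = 0 :=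
      funext fun i => eq_zero_of_forall_mulVec_eq_zero fun x => htop x _ hZ0 i
    have h3 : (fun _ : Fin m => vecMulVec t z) = 0 :=
      γ.symm.injective (by rw [h2, map_zero])
    have h4 := congr_fun h3 i0
    simp only [Pi.zero_apply, vecMulVec_eq_zero] at h4
    rcases h4 with h4 | h4
    · exact ht h4
    · exact hz0 h4
  -- maximality of `b^⊥`: `Q' = b^⊥`
  have hQ'b : ∀ x, (∀ Z : Tuple n m, (∀ p, z ⬝ᵥ p = 0 → ∀ i, Z i *ᵥ p = 0) →
      ∀ i, γ.symm Z i *ᵥ x = 0) → b ⬝ᵥ x = 0 := by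
    intro x hx
    by_contra hbx
    apply hQ'top
    intro y Z hZ i
    have hy' : b ⬝ᵥ (y - ((b ⬝ᵥ y) / (b ⬝ᵥ x)) • x) = 0 := by
      rw [dotProduct_sub, dotProduct_smul, smul_eq_mul, div_mul_cancel₀ _ hbx, sub_self]
    calc γ.symm Z i *ᵥ y
        = γ.symm Z i *ᵥ ((y - ((b ⬝ᵥ y) / (b ⬝ᵥ x)) • x) + ((b ⬝ᵥ y) / (b ⬝ᵥ x)) • x) := by
          rw [sub_add_cancel]
      _ = 0 := by
          rw [mulVec_add, mulVec_smul, hbQ' _ hy' Z hZ i, hx Z hZ i, smul_zero, add_zero]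
  refine ⟨z, hz0, fun X => ?_⟩
  constructor
  · intro h p hp i
    have h1 := ((hQ'X (γ X)).mpr h) p (hbQ' p hp)
    simpa only [LinearEquiv.symm_apply_apply] using h1 i
  · intro h
    refine (hQ'X (γ X)).mp fun q hq i => ?_
    rw [LinearEquiv.symm_apply_apply]
    exact h q (hQ'b q hq) i

/-! ### Transposition: the row versions -/

/-- The conjugate `τ ∘ γ ∘ τ` of a linear automorphism `γ` of `Mat_n^m` by the simultaneous
transpose. [cite: MakamWigderson2021, Thm. 1.13 (proof, elementary route)] -/
theorem exists_conj (γ : Tuple n m ≃ₗ[ℂ] Tuple n m) :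
    ∃ γt : Tuple n m ≃ₗ[ℂ] Tuple n m, (∀ X i, γt X i = (γ (fun j => (X j)ᵀ) i)ᵀ) ∧
      ∀ X i, γt.symm X i = (γ.symm (fun j => (X j)ᵀ) i)ᵀ := by
  let τe : Tuple n m ≃ₗ[ℂ] Tuple n m :=
    LinearEquiv.ofInvolutive (transposeMap n m) fun X => funext fun i => transpose_transpose (X i)
  exact ⟨(τe.trans γ).trans τe, fun X i => rfl, fun X i => rfl⟩

/-- **Hyperplanes to hyperplanes (left kernels)**: the row version of `exists_colHyperplane`,
with `M^{a^⊥} = {X | qᵀ Xᵢ = 0 whenever a ⬝ q = 0}`.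
[cite: MakamWigderson2021, Thm. 1.13 (proof, elementary route)] -/
theorem exists_rowHyperplane (hn : 2 ≤ n) (hm : 1 ≤ m) (γ : Tuple n m ≃ₗ[ℂ] Tuple n m)
    (hr : ∀ w : Fin n → ℂ, w ≠ 0 → ∃ w' : Fin n → ℂ, w' ≠ 0 ∧
      ∀ X : Tuple n m, (∀ i, w' ᵥ* γ X i = 0) ↔ ∀ i, w ᵥ* X i = 0)
    (hr' : ∀ w : Fin n → ℂ, w ≠ 0 → ∃ w' : Fin n → ℂ, w' ≠ 0 ∧
      ∀ X : Tuple n m, (∀ i, w' ᵥ* γ.symm X i = 0) ↔ ∀ i, w ᵥ* X i = 0)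
    {a : Fin n → ℂ} (ha : a ≠ 0) :
    ∃ a' : Fin n → ℂ, a' ≠ 0 ∧ ∀ X : Tuple n m,
      (∀ q, a' ⬝ᵥ q = 0 → ∀ i, q ᵥ* γ X i = 0) ↔ ∀ q, a ⬝ᵥ q = 0 → ∀ i, q ᵥ* X i = 0 := by
  obtain ⟨γt, hγt, hγts⟩ := exists_conj γ
  have hct : ∀ v : Fin n → ℂ, v ≠ 0 → ∃ v' : Fin n → ℂ, v' ≠ 0 ∧
      ∀ X : Tuple n m, (∀ i, γt X i *ᵥ v' = 0) ↔ ∀ i, X i *ᵥ v = 0 := by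
    intro v hv
    obtain ⟨v', hv', h⟩ := hr v hv
    refine ⟨v', hv', fun X => ?_⟩
    have h1 := h fun j => (X j)ᵀ
    simp only [vecMul_transpose] at h1
    simp only [hγt, mulVec_transpose]
    exact h1
  have hct' : ∀ v : Fin n → ℂ, v ≠ 0 → ∃ v' : Fin n → ℂ, v' ≠ 0 ∧
      ∀ X : Tuple n m, (∀ i, γt.symm X i *ᵥ v' = 0) ↔ ∀ i, X i *ᵥ v = 0 := by
    intro v hv
    obtain ⟨v', hv', h⟩ := hr' v hv
    refine ⟨v', hv', fun X => ?_⟩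
    have h1 := h fun j => (X j)ᵀ
    simp only [vecMul_transpose] at h1
    simp only [hγts, mulVec_transpose]
    exact h1
  obtain ⟨a', ha', h⟩ := exists_colHyperplane hn hm γt hct hct' ha
  refine ⟨a', ha', fun X => ?_⟩
  have h1 := h fun j => (X j)ᵀ
  simp only [hγt, mulVec_transpose, transpose_transpose] at h1
  exact h1

/-! ### Rank-one tuples go to rank-one tuples -/

/-- Cancelling a nonzero right factor: `u wᵀ = u' wᵀ`, `w ≠ 0` ⇒ `u = u'`. [folklore] -/
private theorem vecMulVec_left_cancel {u u' w : Fin n → ℂ} (hw : w ≠ 0)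
    (h : vecMulVec u w = vecMulVec u' w) : u = u' := by
  obtain ⟨p, hp⟩ := exists_dotProduct_ne_zero hw
  have h1 := congr_arg (fun A => A *ᵥ p) h
  simp only [MarcusMoyls.vecMulVec_mulVec_eq_smul] at h1
  exact smul_right_injective _ hp h1

/-- Cancelling a nonzero left factor: `u wᵀ = u w'ᵀ`, `u ≠ 0` ⇒ `w = w'`. [folklore] -/
private theorem vecMulVec_right_cancel {u w w' : Fin n → ℂ} (hu : u ≠ 0)
    (h : vecMulVec u w = vecMulVec u w') : w = w' := by
  refine vecMulVec_left_cancel hu ?_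
  rw [← transpose_vecMulVec u w, h, transpose_vecMulVec]

/-- **Comparison of coefficients along an independent pair.**  If
`L₃(c)ᵢ a₃ = L₁(c)ᵢ a₁ + L₂(c)ᵢ a₂` for all `c, i` with `a₁, a₂` independent and `L₁(c₀), L₂(c₀)`
nonzero, then `L₂ = t·L₁` with `t ≠ 0` (evaluate against vectors separating `a₁` from `a₂`).
[cite: MakamWigderson2021, Thm. 1.13 (proof, elementary route)] -/
theorem indepStep {ι : Type*} {a₁ a₂ a₃ : Fin n → ℂ} {L₁ L₂ L₃ : ι → Fin m → ℂ} (ha₁ : a₁ ≠ 0)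
    (hind : ∀ s : ℂ, a₂ ≠ s • a₁)
    (hrel : ∀ c i, L₃ c i • a₃ = L₁ c i • a₁ + L₂ c i • a₂) {c₀ : ι} (h₁ : L₁ c₀ ≠ 0)
    (h₂ : L₂ c₀ ≠ 0) : ∃ t : ℂ, t ≠ 0 ∧ ∀ c, L₂ c = t • L₁ c := by
  obtain ⟨x, y, h1x, h2x, h1y, h2y⟩ := MarcusMoyls.exists_dotProduct_separating ha₁ hind
  have hx : ∀ c i, L₁ c i = L₃ c i * (a₃ ⬝ᵥ x) := fun c i => by
    have := congr_arg (fun v => v ⬝ᵥ x) (hrel c i)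
    simp only [add_dotProduct, smul_dotProduct, smul_eq_mul, h1x, h2x, mul_one, mul_zero,
      add_zero] at this
    exact this.symm
  have hy : ∀ c i, L₂ c i = L₃ c i * (a₃ ⬝ᵥ y) := fun c i => by
    have := congr_arg (fun v => v ⬝ᵥ y) (hrel c i)
    simp only [add_dotProduct, smul_dotProduct, smul_eq_mul, h1y, h2y, mul_one, mul_zero,
      zero_add] at this
    exact this.symm
  obtain ⟨k₁, hk₁⟩ := exists_apply_ne_zero h₁
  obtain ⟨k₂, hk₂⟩ := exists_apply_ne_zero h₂
  have hα : a₃ ⬝ᵥ x ≠ 0 := fun h0 => hk₁ (by rw [hx, h0, mul_zero])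
  have hβ : a₃ ⬝ᵥ y ≠ 0 := fun h0 => hk₂ (by rw [hy, h0, mul_zero])
  refine ⟨(a₃ ⬝ᵥ y) / (a₃ ⬝ᵥ x), div_ne_zero hβ hα, fun c => funext fun i => ?_⟩
  rw [Pi.smul_apply, smul_eq_mul, hy, hx]
  field_simp

/-- **Structure of a kernel-family preserver on decomposable tuples.**  If `γ` and `γ⁻¹` map every
`M_v` onto some `M_{v'}` and every `M^w` onto some `M^{w'}` (`n ≥ 2`, `m ≥ 1`), then there are a
map `L` of `ℂ^m` (nonvanishing off `0`) and a linear map `H` of `Mat_n` taking rank-`≤ 1` matrices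
to rank-`≤ 1` matrices with `γ(c ⊗ A) = L(c) ⊗ H(A)` for all `c, A`.
[cite: MakamWigderson2021, Thm. 1.13 (proof, elementary route)] -/
theorem exists_slice_structure (hn : 2 ≤ n) (hm : 1 ≤ m) (γ : Tuple n m ≃ₗ[ℂ] Tuple n m)
    (hc : ∀ v : Fin n → ℂ, v ≠ 0 → ∃ v' : Fin n → ℂ, v' ≠ 0 ∧
      ∀ X : Tuple n m, (∀ i, γ X i *ᵥ v' = 0) ↔ ∀ i, X i *ᵥ v = 0)
    (hr : ∀ w : Fin n → ℂ, w ≠ 0 → ∃ w' : Fin n → ℂ, w' ≠ 0 ∧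
      ∀ X : Tuple n m, (∀ i, w' ᵥ* γ X i = 0) ↔ ∀ i, w ᵥ* X i = 0)
    (hc' : ∀ v : Fin n → ℂ, v ≠ 0 → ∃ v' : Fin n → ℂ, v' ≠ 0 ∧
      ∀ X : Tuple n m, (∀ i, γ.symm X i *ᵥ v' = 0) ↔ ∀ i, X i *ᵥ v = 0)
    (hr' : ∀ w : Fin n → ℂ, w ≠ 0 → ∃ w' : Fin n → ℂ, w' ≠ 0 ∧
      ∀ X : Tuple n m, (∀ i, w' ᵥ* γ.symm X i = 0) ↔ ∀ i, w ᵥ* X i = 0) :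
    ∃ (L : (Fin m → ℂ) → Fin m → ℂ) (H : Matrix (Fin n) (Fin n) ℂ →ₗ[ℂ] Matrix (Fin n) (Fin n) ℂ),
      (∀ (c : Fin m → ℂ) (A : Matrix (Fin n) (Fin n) ℂ),
        γ (fun i => c i • A) = fun i => L c i • H A) ∧
      (∀ u w : Fin n → ℂ, ∃ u' w' : Fin n → ℂ, H (vecMulVec u w) = vecMulVec u' w') ∧
      ∀ c : Fin m → ℂ, c ≠ 0 → L c ≠ 0 := by
  -- the hyperplane maps `a ↦ a'` (rows) and `b ↦ b'` (columns)
  have hA : ∀ a : Fin n → ℂ, ∃ a' : Fin n → ℂ, a ≠ 0 → a' ≠ 0 ∧ ∀ X : Tuple n m,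
      (∀ q, a' ⬝ᵥ q = 0 → ∀ i, q ᵥ* γ X i = 0) ↔ ∀ q, a ⬝ᵥ q = 0 → ∀ i, q ᵥ* X i = 0 := by
    intro a
    by_cases ha : a = 0
    · exact ⟨0, fun h => absurd ha h⟩
    · obtain ⟨a', ha', h⟩ := exists_rowHyperplane hn hm γ hr hr' ha
      exact ⟨a', fun _ => ⟨ha', h⟩⟩
  choose fA hfA using hA
  have hB : ∀ b : Fin n → ℂ, ∃ b' : Fin n → ℂ, b ≠ 0 → b' ≠ 0 ∧ ∀ X : Tuple n m,
      (∀ p, b' ⬝ᵥ p = 0 → ∀ i, γ X i *ᵥ p = 0) ↔ ∀ p, b ⬝ᵥ p = 0 → ∀ i, X i *ᵥ p = 0 := by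
    intro b
    by_cases hb : b = 0
    · exact ⟨0, fun h => absurd hb h⟩
    · obtain ⟨b', hb', h⟩ := exists_colHyperplane hn hm γ hc hc' hb
      exact ⟨b', fun _ => ⟨hb', h⟩⟩
  choose fB hfB using hB
  -- rank-one transport: `γ(c ⊗ a bᵀ) = Lf a b c ⊗ a' b'ᵀ`
  have hL : ∀ (a b : Fin n → ℂ) (c : Fin m → ℂ), ∃ d : Fin m → ℂ, a ≠ 0 → b ≠ 0 →
      γ (fun i => c i • vecMulVec a b) = fun i => d i • vecMulVec (fA a) (fB b) := by
    intro a b c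
    by_cases ha : a = 0
    · exact ⟨0, fun h => absurd ha h⟩
    by_cases hb : b = 0
    · exact ⟨0, fun _ h => absurd hb h⟩
    obtain ⟨d, hd⟩ := exists_eq_smul_vecMulVec (X := γ fun i => c i • vecMulVec a b)
      (hfA a ha).1 (hfB b hb).1
      (((hfB b hb).2 _).mpr fun p hp i => smul_vecMulVec_mulVec_eq_zero c a hp i)
      (((hfA a ha).2 _).mpr fun q hq i => vecMul_smul_vecMulVec_eq_zero c b hq i)
    exact ⟨d, fun _ _ => hd⟩
  choose Lf hLf using hL
  have hLf0 : ∀ a b c, a ≠ 0 → b ≠ 0 → c ≠ 0 → Lf a b c ≠ 0 := by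
    intro a b c ha hb hc0 h0
    have h1 := hLf a b c ha hb
    rw [h0] at h1
    have h2 : (fun i => c i • vecMulVec a b) = 0 := γ.injective (by
      rw [h1, map_zero]; funext i; simp)
    have hab : vecMulVec a b ≠ 0 := by
      rw [Ne, vecMulVec_eq_zero, not_or]; exact ⟨ha, hb⟩
    exact hc0 (eq_zero_of_smul_eq_zero hab h2)
  -- independence is transported
  have hAind : ∀ a₁ a₂ : Fin n → ℂ, a₁ ≠ 0 → (∀ s : ℂ, a₂ ≠ s • a₁) →
      ∀ s : ℂ, fA a₂ ≠ s • fA a₁ := by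
    intro a₁ a₂ ha₁ hind s hs
    have ha₂ : a₂ ≠ 0 := fun h => hind 0 (by rw [h, zero_smul])
    have hs0 : s ≠ 0 := by
      rintro rfl
      exact (hfA a₂ ha₂).1 (by rw [hs, zero_smul])
    -- `M^{a₁^⊥} = M^{a₂^⊥}`, tested on `a₁ tᵀ`
    obtain ⟨t, ht, -⟩ := exists_ne_zero_dotProduct_eq_zero hn 0
    have h1 : ∀ q, a₁ ⬝ᵥ q = 0 → ∀ i : Fin m, q ᵥ* (fun _ : Fin m => vecMulVec a₁ t) i = 0 :=
      fun q hq i => by rw [vecMul_vecMulVec_eq_smul, dotProduct_comm, hq, zero_smul]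
    have h2 := ((hfA a₁ ha₁).2 _).mpr h1
    have h3 : ∀ q, fA a₂ ⬝ᵥ q = 0 → ∀ i, q ᵥ* γ (fun _ : Fin m => vecMulVec a₁ t) i = 0 := by
      intro q hq
      refine h2 q ?_
      have : s * (fA a₁ ⬝ᵥ q) = 0 := by rw [← smul_eq_mul, ← smul_dotProduct, ← hs, hq]
      exact (mul_eq_zero.mp this).resolve_left hs0
    have h4 := ((hfA a₂ ha₂).2 _).mp h3
    obtain ⟨r, hr⟩ := exists_eq_smul_of_forall_dotProduct ha₂ (v := a₁) fun q hq => by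
      have h5 := h4 q hq ⟨0, hm⟩
      rw [vecMul_vecMulVec_eq_smul, smul_eq_zero, dotProduct_comm] at h5
      exact h5.resolve_right ht
    have hr0 : r ≠ 0 := by
      rintro rfl
      exact ha₁ (by rw [hr, zero_smul])
    exact hind r⁻¹ (by rw [hr, smul_smul, inv_mul_cancel₀ hr0, one_smul])
  have hBind : ∀ b₁ b₂ : Fin n → ℂ, b₁ ≠ 0 → (∀ s : ℂ, b₂ ≠ s • b₁) →
      ∀ s : ℂ, fB b₂ ≠ s • fB b₁ := by
    intro b₁ b₂ hb₁ hind s hs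
    have hb₂ : b₂ ≠ 0 := fun h => hind 0 (by rw [h, zero_smul])
    have hs0 : s ≠ 0 := by
      rintro rfl
      exact (hfB b₂ hb₂).1 (by rw [hs, zero_smul])
    obtain ⟨t, ht, -⟩ := exists_ne_zero_dotProduct_eq_zero hn 0
    have h1 : ∀ p, b₁ ⬝ᵥ p = 0 → ∀ i : Fin m, (fun _ : Fin m => vecMulVec t b₁) i *ᵥ p = 0 :=
      fun p hp i => by rw [MarcusMoyls.vecMulVec_mulVec_eq_smul, hp, zero_smul]
    have h2 := ((hfB b₁ hb₁).2 _).mpr h1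
    have h3 : ∀ p, fB b₂ ⬝ᵥ p = 0 → ∀ i, γ (fun _ : Fin m => vecMulVec t b₁) i *ᵥ p = 0 := by
      intro p hp
      refine h2 p ?_
      have : s * (fB b₁ ⬝ᵥ p) = 0 := by rw [← smul_eq_mul, ← smul_dotProduct, ← hs, hp]
      exact (mul_eq_zero.mp this).resolve_left hs0
    have h4 := ((hfB b₂ hb₂).2 _).mp h3
    obtain ⟨r, hr⟩ := exists_eq_smul_of_forall_dotProduct hb₂ (v := b₁) fun p hp => by
      have h5 := h4 p hp ⟨0, hm⟩
      rw [MarcusMoyls.vecMulVec_mulVec_eq_smul, smul_eq_zero] at h5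
      exact h5.resolve_right ht
    have hr0 : r ≠ 0 := by
      rintro rfl
      exact hb₁ (by rw [hr, zero_smul])
    exact hind r⁻¹ (by rw [hr, smul_smul, inv_mul_cancel₀ hr0, one_smul])
  -- the slot relations
  have hrelA : ∀ a₁ a₂ b : Fin n → ℂ, a₁ ≠ 0 → a₂ ≠ 0 → a₁ + a₂ ≠ 0 → b ≠ 0 → ∀ c i,
      Lf (a₁ + a₂) b c i • fA (a₁ + a₂) = Lf a₁ b c i • fA a₁ + Lf a₂ b c i • fA a₂ := by
    intro a₁ a₂ b ha₁ ha₂ ha₃ hb c i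
    have h := hLf (a₁ + a₂) b c ha₃ hb
    have hsplit : (fun i => c i • vecMulVec (a₁ + a₂) b) =
        (fun i => c i • vecMulVec a₁ b) + fun i => c i • vecMulVec a₂ b := by
      funext i; simp only [Pi.add_apply, add_vecMulVec, smul_add]
    rw [hsplit, map_add, hLf a₁ b c ha₁ hb, hLf a₂ b c ha₂ hb] at h
    have hi := congr_fun h i
    simp only [Pi.add_apply, ← smul_vecMulVec, ← add_vecMulVec] at hi
    exact (vecMulVec_left_cancel (hfB b hb).1 hi).symm
  have hrelB : ∀ a b₁ b₂ : Fin n → ℂ, a ≠ 0 → b₁ ≠ 0 → b₂ ≠ 0 → b₁ + b₂ ≠ 0 → ∀ c i,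
      Lf a (b₁ + b₂) c i • fB (b₁ + b₂) = Lf a b₁ c i • fB b₁ + Lf a b₂ c i • fB b₂ := by
    intro a b₁ b₂ ha hb₁ hb₂ hb₃ c i
    have h := hLf a (b₁ + b₂) c ha hb₃
    have hsplit : (fun i => c i • vecMulVec a (b₁ + b₂)) =
        (fun i => c i • vecMulVec a b₁) + fun i => c i • vecMulVec a b₂ := by
      funext i; simp only [Pi.add_apply, vecMulVec_add, smul_add]
    rw [hsplit, map_add, hLf a b₁ c ha hb₁, hLf a b₂ c ha hb₂] at h
    have hi := congr_fun h i
    simp only [Pi.add_apply, ← vecMulVec_smul, ← vecMulVec_add] at hi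
    exact (vecMulVec_right_cancel (hfA a ha).1 hi).symm
  -- proportionality along independent pairs
  have e : Fin m → ℂ := Pi.single ⟨0, hm⟩ 1
  have he : (Pi.single ⟨0, hm⟩ 1 : Fin m → ℂ) ≠ 0 := MarcusMoyls.single_one_ne_zero _
  have hstepA : ∀ a₁ a₂ b : Fin n → ℂ, a₁ ≠ 0 → (∀ s : ℂ, a₂ ≠ s • a₁) → b ≠ 0 →
      ∃ t : ℂ, t ≠ 0 ∧ ∀ c, Lf a₂ b c = t • Lf a₁ b c := by
    intro a₁ a₂ b ha₁ hind hb
    have ha₂ : a₂ ≠ 0 := fun h => hind 0 (by rw [h, zero_smul])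
    have ha₃ : a₁ + a₂ ≠ 0 := fun h => hind (-1) (by
      rw [neg_one_smul]; exact eq_neg_of_add_eq_zero_right h)
    exact indepStep (L₃ := Lf (a₁ + a₂) b) (hfA a₁ ha₁).1 (hAind a₁ a₂ ha₁ hind)
      (fun c i => hrelA a₁ a₂ b ha₁ ha₂ ha₃ hb c i)
      (hLf0 a₁ b _ ha₁ hb he) (hLf0 a₂ b _ ha₂ hb he)
  have hstepB : ∀ a b₁ b₂ : Fin n → ℂ, a ≠ 0 → b₁ ≠ 0 → (∀ s : ℂ, b₂ ≠ s • b₁) →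
      ∃ t : ℂ, t ≠ 0 ∧ ∀ c, Lf a b₂ c = t • Lf a b₁ c := by
    intro a b₁ b₂ ha hb₁ hind
    have hb₂ : b₂ ≠ 0 := fun h => hind 0 (by rw [h, zero_smul])
    have hb₃ : b₁ + b₂ ≠ 0 := fun h => hind (-1) (by
      rw [neg_one_smul]; exact eq_neg_of_add_eq_zero_right h)
    exact indepStep (L₃ := Lf a (b₁ + b₂)) (hfB b₁ hb₁).1 (hBind b₁ b₂ hb₁ hind)
      (fun c i => hrelB a b₁ b₂ ha hb₁ hb₂ hb₃ c i)
      (hLf0 a b₁ _ ha hb₁ he) (hLf0 a b₂ _ ha hb₂ he)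
  -- everything is proportional to `L₀ = Lf e₀ e₀`
  set i0 : Fin n := ⟨0, by omega⟩ with hi0
  set i1 : Fin n := ⟨1, by omega⟩ with hi1
  have h01 : i0 ≠ i1 := by simp [hi0, hi1, Fin.ext_iff]
  have hE0 : (Pi.single i0 1 : Fin n → ℂ) ≠ 0 := MarcusMoyls.single_one_ne_zero _
  have hE1 : (Pi.single i1 1 : Fin n → ℂ) ≠ 0 := MarcusMoyls.single_one_ne_zero _
  have hE01 : ∀ s : ℂ, (Pi.single i1 1 : Fin n → ℂ) ≠ s • Pi.single i0 1 :=
    MarcusMoyls.single_ne_smul_single h01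
  -- reduction of a general nonzero vector to `e₀` through `e₁`
  have hreduce : ∀ (R : (Fin n → ℂ) → (Fin n → ℂ) → Prop),
      (∀ a₁ a₂, a₁ ≠ 0 → (∀ s : ℂ, a₂ ≠ s • a₁) → R a₂ a₁) →
      (∀ a₁ a₂ a₃, R a₃ a₂ → R a₂ a₁ → R a₃ a₁) →
      ∀ a, a ≠ 0 → R a (Pi.single i0 1) := by
    intro R hstep htrans a ha
    by_cases h : ∃ s : ℂ, a = s • Pi.single i0 1
    · obtain ⟨s, hs⟩ := h
      have ha1 : ∀ r : ℂ, a ≠ r • Pi.single i1 1 := by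
        intro r hr
        have := congr_fun (hs.symm.trans hr) i0
        simp only [Pi.smul_apply, Pi.single_apply, if_true, h01, if_false, smul_eq_mul, mul_one,
          mul_zero] at this
        exact ha (by rw [hs, this, zero_smul])
      exact htrans _ _ _ (hstep _ _ hE1 ha1) (hstep _ _ hE0 hE01)
    · push Not at h
      exact hstep _ _ hE0 h
  have hpropA : ∀ a b : Fin n → ℂ, a ≠ 0 → b ≠ 0 →
      ∃ t : ℂ, t ≠ 0 ∧ ∀ c, Lf a b c = t • Lf (Pi.single i0 1) b c := by
    intro a b ha hb
    refine hreduce (fun a₂ a₁ => ∃ t : ℂ, t ≠ 0 ∧ ∀ c, Lf a₂ b c = t • Lf a₁ b c)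
      (fun a₁ a₂ ha₁ hind => hstepA a₁ a₂ b ha₁ hind hb) ?_ a ha
    rintro a₁ a₂ a₃ ⟨t, ht, h⟩ ⟨t', ht', h'⟩
    exact ⟨t * t', mul_ne_zero ht ht', fun c => by rw [h, h', smul_smul]⟩
  have hpropB : ∀ a b : Fin n → ℂ, a ≠ 0 → b ≠ 0 →
      ∃ t : ℂ, t ≠ 0 ∧ ∀ c, Lf a b c = t • Lf a (Pi.single i0 1) c := by
    intro a b ha hb
    refine hreduce (fun b₂ b₁ => ∃ t : ℂ, t ≠ 0 ∧ ∀ c, Lf a b₂ c = t • Lf a b₁ c)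
      (fun b₁ b₂ hb₁ hind => hstepB a b₁ b₂ ha hb₁ hind) ?_ b hb
    rintro b₁ b₂ b₃ ⟨t, ht, h⟩ ⟨t', ht', h'⟩
    exact ⟨t * t', mul_ne_zero ht ht', fun c => by rw [h, h', smul_smul]⟩
  have hprop : ∀ a b : Fin n → ℂ, a ≠ 0 → b ≠ 0 →
      ∃ t : ℂ, t ≠ 0 ∧ ∀ c, Lf a b c = t • Lf (Pi.single i0 1) (Pi.single i0 1) c := by
    intro a b ha hb
    obtain ⟨t, ht, h⟩ := hpropA a b ha hb
    obtain ⟨t', ht', h'⟩ := hpropB (Pi.single i0 1) b hE0 hb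
    exact ⟨t * t', mul_ne_zero ht ht', fun c => by rw [h, h', smul_smul]⟩
  -- the slice `H`
  set L₀ : (Fin m → ℂ) → Fin m → ℂ := Lf (Pi.single i0 1) (Pi.single i0 1) with hL₀
  have hL₀e : L₀ (Pi.single ⟨0, hm⟩ 1) ≠ 0 := hLf0 _ _ _ hE0 hE0 he
  obtain ⟨k0, hk0⟩ := exists_apply_ne_zero hL₀e
  let H : Matrix (Fin n) (Fin n) ℂ →ₗ[ℂ] Matrix (Fin n) (Fin n) ℂ :=
    (L₀ (Pi.single ⟨0, hm⟩ 1) k0)⁻¹ •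
      ((LinearMap.proj k0).comp ((γ : Tuple n m →ₗ[ℂ] Tuple n m).comp
        (LinearMap.pi fun i => ((Pi.single ⟨0, hm⟩ 1 : Fin m → ℂ) i) • LinearMap.id)))
  have hH : ∀ A, H A = (L₀ (Pi.single ⟨0, hm⟩ 1) k0)⁻¹ •
      γ (fun i => (Pi.single ⟨0, hm⟩ 1 : Fin m → ℂ) i • A) k0 := fun A => rfl
  have hHab : ∀ a b : Fin n → ℂ, a ≠ 0 → b ≠ 0 → ∀ c : Fin m → ℂ,
      γ (fun i => c i • vecMulVec a b) = fun i => L₀ c i • H (vecMulVec a b) := by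
    intro a b ha hb c
    obtain ⟨t, ht, h⟩ := hprop a b ha hb
    have hHv : H (vecMulVec a b) = t • vecMulVec (fA a) (fB b) := by
      rw [hH, hLf a b _ ha hb, h]
      simp only [Pi.smul_apply, smul_eq_mul]
      rw [mul_smul, smul_smul, smul_smul, mul_comm, ← mul_assoc, mul_inv_cancel₀ hk0, one_mul]
    rw [hLf a b c ha hb, h, hHv]
    funext i
    rw [Pi.smul_apply, smul_eq_mul, smul_smul, mul_comm]
  refine ⟨L₀, H, fun c A => ?_, fun u w => ?_, fun c hc0 => hLf0 _ _ c hE0 hE0 hc0⟩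
  · -- extend from rank-one matrices to all matrices
    induction A using Matrix.induction_on' with
    | h_zero =>
      funext i
      simp only [smul_zero, map_zero]
      exact congr_fun (map_zero γ) i
    | h_add A B hA hB =>
      have hsplit : (fun i => c i • (A + B)) = (fun i => c i • A) + fun i => c i • B := by
        funext i; simp only [Pi.add_apply, smul_add]
      rw [hsplit, map_add, hA, hB, map_add]
      funext i
      simp only [Pi.add_apply, smul_add]
    | h_std_basis j k x =>
      have hsingle : single j k x = x • vecMulVec (Pi.single j 1) (Pi.single k (1 : ℂ)) := by
        rw [← single_eq_single_vecMulVec_single, smul_single, smul_eq_mul, mul_one]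
      have hsplit : (fun i => c i • single j k x) =
          x • fun i => c i • vecMulVec (Pi.single j 1) (Pi.single k (1 : ℂ)) := by
        funext i; rw [Pi.smul_apply, hsingle, smul_comm]
      rw [hsplit, map_smul, hHab _ _ (MarcusMoyls.single_one_ne_zero j)
        (MarcusMoyls.single_one_ne_zero k), hsingle, map_smul]
      funext i
      rw [Pi.smul_apply, smul_comm]
  · by_cases hu : u = 0
    · refine ⟨0, 0, ?_⟩
      rw [hu]; simp
    by_cases hw : w = 0
    · refine ⟨0, 0, ?_⟩
      rw [hw]; simp
    obtain ⟨t, ht, h⟩ := hprop u w hu hw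
    refine ⟨t • fA u, fB w, ?_⟩
    rw [hH, hLf u w _ hu hw, h, smul_vecMulVec]
    simp only [Pi.smul_apply, smul_eq_mul]
    rw [mul_smul, smul_smul, smul_smul, mul_comm, ← mul_assoc, mul_inv_cancel₀ hk0, one_mul]

/-! ### The core: family-preserving maps are in `G_{n,m}` (up to `τ`) -/

/-- Unfolding the tree's `transposeMap`. [cite: MakamWigderson2021, Thm. 1.13] -/
theorem transposeMap_apply (X : Tuple n m) (i : Fin m) : transposeMap n m X i = (X i)ᵀ := rfl

/-- `tripleAct P Q C (c ⊗ A) = (P c) ⊗ (Q A Cᵀ)`. [cite: MakamWigderson2021, §1.3 (p0006:L14–18)] -/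
theorem tripleAct_smul (P : Matrix (Fin m) (Fin m) ℂ) (Q C : Matrix (Fin n) (Fin n) ℂ)
    (c : Fin m → ℂ) (A : Matrix (Fin n) (Fin n) ℂ) :
    tripleAct P Q C (fun i => c i • A) = fun i => (P *ᵥ c) i • (Q * A * Cᵀ) := by
  funext i
  rw [tripleAct_apply_eq_sum, mulVec, dotProduct, Finset.sum_smul]
  refine Finset.sum_congr rfl fun j _ => ?_
  rw [Matrix.mul_smul, Matrix.smul_mul, smul_smul]

/-- **Core theorem.**  A linear automorphism `γ` of `Mat_n^m` (`n ≥ 2`, `m ≥ 1`) such that `γ` and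
`γ⁻¹` map every `M_v` onto some `M_{v'}` and every `M^w` onto some `M^{w'}` is
`X ↦ (∑ⱼ p_{ij} U Xⱼ V)ᵢ` or `X ↦ (∑ⱼ p_{ij} U Xⱼᵀ V)ᵢ` with `P, U, V` invertible.
[cite: MakamWigderson2021, Thm. 1.13 (proof, elementary route)] -/
theorem exists_eq_tripleAct_of_kernelFamilies (hn : 2 ≤ n) (hm : 1 ≤ m)
    (γ : Tuple n m ≃ₗ[ℂ] Tuple n m)
    (hc : ∀ v : Fin n → ℂ, v ≠ 0 → ∃ v' : Fin n → ℂ, v' ≠ 0 ∧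
      ∀ X : Tuple n m, (∀ i, γ X i *ᵥ v' = 0) ↔ ∀ i, X i *ᵥ v = 0)
    (hr : ∀ w : Fin n → ℂ, w ≠ 0 → ∃ w' : Fin n → ℂ, w' ≠ 0 ∧
      ∀ X : Tuple n m, (∀ i, w' ᵥ* γ X i = 0) ↔ ∀ i, w ᵥ* X i = 0)
    (hc' : ∀ v : Fin n → ℂ, v ≠ 0 → ∃ v' : Fin n → ℂ, v' ≠ 0 ∧
      ∀ X : Tuple n m, (∀ i, γ.symm X i *ᵥ v' = 0) ↔ ∀ i, X i *ᵥ v = 0)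
    (hr' : ∀ w : Fin n → ℂ, w ≠ 0 → ∃ w' : Fin n → ℂ, w' ≠ 0 ∧
      ∀ X : Tuple n m, (∀ i, w' ᵥ* γ.symm X i = 0) ↔ ∀ i, w ᵥ* X i = 0) :
    ∃ (P : Matrix (Fin m) (Fin m) ℂ) (U V : Matrix (Fin n) (Fin n) ℂ),
      IsUnit P ∧ IsUnit U ∧ IsUnit V ∧
      ((∀ X, γ X = tripleAct P U Vᵀ X) ∨ ∀ X, γ X = tripleAct P U Vᵀ (transposeMap n m X)) := by
  obtain ⟨L, H, hLH, hH1, -⟩ := exists_slice_structure hn hm γ hc hr hc' hr'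
  obtain ⟨L', H', hLH', hH1', -⟩ := exists_slice_structure hn hm γ.symm hc' hr'
    (by simpa only [LinearEquiv.symm_symm] using hc) (by simpa only [LinearEquiv.symm_symm] using hr)
  have j0 : Fin m := ⟨0, hm⟩
  have he1 : (Pi.single ⟨0, hm⟩ (1 : ℂ) : Fin m → ℂ) ⟨0, hm⟩ = 1 := Pi.single_eq_same _ _
  -- `H` is bijective
  have hHinj : Function.Injective H := by
    refine (injective_iff_map_eq_zero H).mpr fun A hA => ?_
    have h1 := hLH (Pi.single ⟨0, hm⟩ 1) A
    rw [hA] at h1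
    have h2 : (fun i => (Pi.single ⟨0, hm⟩ (1 : ℂ) : Fin m → ℂ) i • A) = 0 :=
      γ.injective (by rw [h1, map_zero]; funext i; simp)
    have h3 := congr_fun h2 ⟨0, hm⟩
    simpa only [he1, one_smul, Pi.zero_apply] using h3
  have hHsurj : Function.Surjective H := LinearMap.surjective_of_injective hHinj
  let He : Matrix (Fin n) (Fin n) ℂ ≃ₗ[ℂ] Matrix (Fin n) (Fin n) ℂ :=
    LinearEquiv.ofBijective H ⟨hHinj, hHsurj⟩
  have hHe : ∀ A, He A = H A := fun A => rfl
  have hST : ∀ X, (He.symm : Matrix (Fin n) (Fin n) ℂ →ₗ[ℂ] Matrix (Fin n) (Fin n) ℂ) (H X) = X :=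
    fun X => by rw [← hHe]; exact He.symm_apply_apply X
  have hTS : ∀ X, H ((He.symm : Matrix (Fin n) (Fin n) ℂ →ₗ[ℂ] Matrix (Fin n) (Fin n) ℂ) X) = X :=
    fun X => by rw [← hHe]; exact He.apply_symm_apply X
  -- `H⁻¹` preserves rank `≤ 1` (from the analysis of `γ⁻¹`)
  have hS1 : ∀ u w : Fin n → ℂ, ∃ u' w' : Fin n → ℂ,
      (He.symm : Matrix (Fin n) (Fin n) ℂ →ₗ[ℂ] Matrix (Fin n) (Fin n) ℂ) (vecMulVec u w) =
        vecMulVec u' w' := by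
    intro u w
    obtain ⟨u₁, w₁, h1⟩ := hH1' u w
    have h2 : (fun i => (Pi.single ⟨0, hm⟩ (1 : ℂ) : Fin m → ℂ) i • vecMulVec u w) =
        fun i => L (L' (Pi.single ⟨0, hm⟩ 1)) i • H (vecMulVec u₁ w₁) := by
      have := hLH (L' (Pi.single ⟨0, hm⟩ 1)) (H' (vecMulVec u w))
      rw [← hLH' (Pi.single ⟨0, hm⟩ 1) (vecMulVec u w), LinearEquiv.apply_symm_apply, h1] at this
      exact this
    have h3 := congr_fun h2 ⟨0, hm⟩
    simp only [he1, one_smul] at h3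
    refine ⟨L (L' (Pi.single ⟨0, hm⟩ 1)) ⟨0, hm⟩ • u₁, w₁, ?_⟩
    rw [h3, ← map_smul, hST, smul_vecMulVec]
  -- Marcus–Moyls
  have h01 : (⟨0, by omega⟩ : Fin n) ≠ ⟨1, by omega⟩ := by simp [Fin.ext_iff]
  obtain ⟨U, V, hUV⟩ :=
    MarcusMoyls.exists_sandwich_or_transpose_sandwich hST hTS hH1 hS1 h01
  -- expansion of `γ X` along `X = ∑ⱼ eⱼ ⊗ Xⱼ`
  have hexp : ∀ X : Tuple n m, ∀ i, γ X i = ∑ j, L (Pi.single j 1) i • H (X j) := by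
    intro X i
    have hX : X = ∑ j, fun i => (Pi.single j (1 : ℂ) : Fin m → ℂ) i • X j := by
      funext i'
      rw [Finset.sum_apply]
      simp only [Pi.single_apply, ite_smul, one_smul, zero_smul, Finset.sum_ite_eq,
        Finset.mem_univ, if_true]
    conv_lhs => rw [hX]
    rw [map_sum, Finset.sum_apply]
    exact Finset.sum_congr rfl fun j _ => by rw [hLH]
  let P : Matrix (Fin m) (Fin m) ℂ := Matrix.of fun i j => L (Pi.single j 1) i
  have hPc : ∀ (c : Fin m → ℂ) (A : Matrix (Fin n) (Fin n) ℂ),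
      γ (fun i => c i • A) = fun i => (P *ᵥ c) i • H A := by
    intro c A
    funext i
    rw [hexp, mulVec, dotProduct, Finset.sum_smul]
    refine Finset.sum_congr rfl fun j _ => ?_
    rw [map_smul, smul_smul]
    rfl
  -- invertibility
  have hP : IsUnit P := by
    rw [← mulVec_injective_iff_isUnit]
    intro c c' hcc
    rw [← sub_eq_zero]
    have h0 : P *ᵥ (c - c') = 0 := by rw [mulVec_sub, hcc, sub_self]
    have hE : vecMulVec (Pi.single (⟨0, by omega⟩ : Fin n) (1 : ℂ))
        (Pi.single (⟨0, by omega⟩ : Fin n) (1 : ℂ)) ≠ 0 := by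
      rw [Ne, vecMulVec_eq_zero, not_or]
      exact ⟨MarcusMoyls.single_one_ne_zero _, MarcusMoyls.single_one_ne_zero _⟩
    refine eq_zero_of_smul_eq_zero hE (γ.injective ?_)
    rw [hPc, h0, map_zero]
    funext i
    simp
  have hUV1 : IsUnit U ∧ IsUnit V := by
    obtain ⟨A, hA⟩ := hHsurj 1
    have key : ∀ B : Matrix (Fin n) (Fin n) ℂ, U * B * V = 1 → IsUnit U ∧ IsUnit V := by
      intro B hB
      have hdet := congr_arg Matrix.det hB
      rw [det_mul, det_mul, det_one] at hdet
      refine ⟨(Matrix.isUnit_iff_isUnit_det U).mpr (isUnit_iff_ne_zero.mpr fun h0 => ?_),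
        (Matrix.isUnit_iff_isUnit_det V).mpr (isUnit_iff_ne_zero.mpr fun h0 => ?_)⟩
      · rw [h0, zero_mul, zero_mul] at hdet; exact zero_ne_one hdet
      · rw [h0, mul_zero] at hdet; exact zero_ne_one hdet
    rcases hUV with h | h
    · exact key A (by rw [← h, hA])
    · exact key Aᵀ (by rw [← h, hA])
  refine ⟨P, U, V, hP, hUV1.1, hUV1.2, ?_⟩
  rcases hUV with h | h
  · left
    intro X
    funext i
    rw [hexp, tripleAct_apply_eq_sum]
    simp only [P, Matrix.of_apply, h, transpose_transpose]
  · right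
    intro X
    funext i
    rw [hexp, tripleAct_apply_eq_sum]
    simp only [P, Matrix.of_apply, h, transpose_transpose, transposeMap_apply]

/-! ### Family separation: `γ` preserves or swaps the two kernel families -/

/-- Not both `γ(M_{v₁}) = M_{v₁'}` and `γ(M_{v₂}) = M^{w'}` (three members contain
`M_{v₁} ∩ M_{v₂}`, only two contain `M_{v₁'} ∩ M^{w'}`).
[cite: MakamWigderson2021, Thm. 1.13 (proof, elementary route)] -/
theorem not_colCol_colRow (hn : 2 ≤ n) (hm : 1 ≤ m) (γ : Tuple n m ≃ₗ[ℂ] Tuple n m)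
    {v₁ v₂ v₁' w' : Fin n → ℂ} (hv₁ : v₁ ≠ 0) (hv₂ : v₂ ≠ 0) (hv₁' : v₁' ≠ 0) (hw' : w' ≠ 0)
    (h₁ : ∀ X : Tuple n m, (∀ i, γ X i *ᵥ v₁' = 0) ↔ ∀ i, X i *ᵥ v₁ = 0)
    (h₂ : ∀ X : Tuple n m, (∀ i, w' ᵥ* γ X i = 0) ↔ ∀ i, X i *ᵥ v₂ = 0)
    (hcol : ∀ v : Fin n → ℂ, v ≠ 0 →
      (∃ v' : Fin n → ℂ, v' ≠ 0 ∧ ∀ X : Tuple n m, (∀ i, γ X i *ᵥ v' = 0) ↔ ∀ i, X i *ᵥ v = 0) ∨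
      (∃ w'' : Fin n → ℂ, w'' ≠ 0 ∧ ∀ X : Tuple n m, (∀ i, w'' ᵥ* γ X i = 0) ↔ ∀ i, X i *ᵥ v = 0)) :
    False := by
  by_cases hdep : ∃ s : ℂ, v₂ = s • v₁
  · obtain ⟨s, hs⟩ := hdep
    have hs0 : s ≠ 0 := by rintro rfl; exact hv₂ (by rw [hs, zero_smul])
    refine not_col_iff_row hn hm hw' (v := v₁') fun Y => ?_
    have e1 := h₁ (γ.symm Y)
    have e2 := h₂ (γ.symm Y)
    simp only [LinearEquiv.apply_symm_apply] at e1 e2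
    exact e1.trans ((col_iff_col_of_eq_smul hs0 hs _).symm.trans e2.symm)
  · push Not at hdep
    have hv₃ : v₁ + v₂ ≠ 0 := fun h => hdep (-1) (by
      rw [neg_one_smul]; exact eq_neg_of_add_eq_zero_right h)
    rcases hcol (v₁ + v₂) hv₃ with ⟨v₃', hv₃', h₃⟩ | ⟨w₃', hw₃', h₃⟩
    · have hsub : ∀ Y : Tuple n m, (∀ i, Y i *ᵥ v₁' = 0) → (∀ i, w' ᵥ* Y i = 0) →
          ∀ i, Y i *ᵥ v₃' = 0 := by
        intro Y hY1 hY2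
        have e1 := (h₁ (γ.symm Y)).mp (by simpa only [LinearEquiv.apply_symm_apply] using hY1)
        have e2 := (h₂ (γ.symm Y)).mp (by simpa only [LinearEquiv.apply_symm_apply] using hY2)
        have e3 := (h₃ (γ.symm Y)).mpr fun i => by rw [mulVec_add, e1 i, e2 i, add_zero]
        simpa only [LinearEquiv.apply_symm_apply] using e3
      obtain ⟨s, hs⟩ := exists_eq_smul_of_col_inter_row_subset_col hn hm hv₁' hsub
      have hs0 : s ≠ 0 := by rintro rfl; exact hv₃' (by rw [hs, zero_smul])
      obtain ⟨r, hr⟩ := exists_eq_smul_of_col_subset_col hn hm hv₁ (u := v₁ + v₂) fun X hX =>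
        (h₃ X).mp ((col_iff_col_of_eq_smul hs0 hs _).mpr ((h₁ X).mpr hX))
      exact hdep (r - 1) (by rw [sub_smul, one_smul, ← hr, add_sub_cancel_left])
    · have hsub : ∀ Y : Tuple n m, (∀ i, Y i *ᵥ v₁' = 0) → (∀ i, w' ᵥ* Y i = 0) →
          ∀ i, w₃' ᵥ* Y i = 0 := by
        intro Y hY1 hY2
        have e1 := (h₁ (γ.symm Y)).mp (by simpa only [LinearEquiv.apply_symm_apply] using hY1)
        have e2 := (h₂ (γ.symm Y)).mp (by simpa only [LinearEquiv.apply_symm_apply] using hY2)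
        have e3 := (h₃ (γ.symm Y)).mpr fun i => by rw [mulVec_add, e1 i, e2 i, add_zero]
        simpa only [LinearEquiv.apply_symm_apply] using e3
      obtain ⟨s, hs⟩ := exists_eq_smul_of_col_inter_row_subset_row hn hm hw' hsub
      have hs0 : s ≠ 0 := by rintro rfl; exact hw₃' (by rw [hs, zero_smul])
      obtain ⟨r, hr⟩ := exists_eq_smul_of_col_subset_col hn hm hv₂ (u := v₁ + v₂) fun X hX =>
        (h₃ X).mp ((row_iff_row_of_eq_smul hs0 hs _).mpr ((h₂ X).mpr hX))
      by_cases hr1 : r - 1 = 0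
      · exact hv₁ (by
          have : v₁ = (r - 1) • v₂ := by rw [sub_smul, one_smul, ← hr, add_sub_cancel_right]
          rw [this, hr1, zero_smul])
      · exact hdep (r - 1)⁻¹ (by
          have : v₁ = (r - 1) • v₂ := by rw [sub_smul, one_smul, ← hr, add_sub_cancel_right]
          rw [this, smul_smul, inv_mul_cancel₀ hr1, one_smul])

/-- Not both `γ(M_v) = M_{v'}` and `γ(M^w) = M_{v''}` (using the hypothesis on `γ⁻¹`).
[cite: MakamWigderson2021, Thm. 1.13 (proof, elementary route)] -/
theorem not_colCol_rowCol (hn : 2 ≤ n) (hm : 1 ≤ m) (γ : Tuple n m ≃ₗ[ℂ] Tuple n m)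
    {v w v' v'' : Fin n → ℂ} (hv : v ≠ 0) (hw : w ≠ 0) (hv' : v' ≠ 0) (hv'' : v'' ≠ 0)
    (h₁ : ∀ X : Tuple n m, (∀ i, γ X i *ᵥ v' = 0) ↔ ∀ i, X i *ᵥ v = 0)
    (h₂ : ∀ X : Tuple n m, (∀ i, γ X i *ᵥ v'' = 0) ↔ ∀ i, w ᵥ* X i = 0)
    (hcol' : ∀ u : Fin n → ℂ, u ≠ 0 →
      (∃ u' : Fin n → ℂ, u' ≠ 0 ∧ ∀ X : Tuple n m, (∀ i, γ.symm X i *ᵥ u' = 0) ↔ ∀ i, X i *ᵥ u = 0) ∨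
      (∃ w₃ : Fin n → ℂ, w₃ ≠ 0 ∧ ∀ X : Tuple n m, (∀ i, w₃ ᵥ* γ.symm X i = 0) ↔ ∀ i, X i *ᵥ u = 0)) :
    False := by
  by_cases hdep : ∃ s : ℂ, v'' = s • v'
  · obtain ⟨s, hs⟩ := hdep
    have hs0 : s ≠ 0 := by rintro rfl; exact hv'' (by rw [hs, zero_smul])
    exact not_col_iff_row hn hm hw (v := v) fun X =>
      (h₁ X).symm.trans ((col_iff_col_of_eq_smul hs0 hs _).symm.trans (h₂ X))
  · push Not at hdep
    have hu : v' + v'' ≠ 0 := fun h => hdep (-1) (by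
      rw [neg_one_smul]; exact eq_neg_of_add_eq_zero_right h)
    rcases hcol' (v' + v'') hu with ⟨u', hu', h₃⟩ | ⟨w₃, hw₃, h₃⟩
    · -- `h₃`: `X ∈ M_{u'} ↔ γ X ∈ M_{v'+v''}`
      have h₃' : ∀ X : Tuple n m, (∀ i, X i *ᵥ u' = 0) ↔ ∀ i, γ X i *ᵥ (v' + v'') = 0 := by
        intro X
        have := h₃ (γ X)
        simp only [LinearEquiv.symm_apply_apply] at this
        exact this
      have hsub : ∀ X : Tuple n m, (∀ i, X i *ᵥ v = 0) → (∀ i, w ᵥ* X i = 0) →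
          ∀ i, X i *ᵥ u' = 0 := by
        intro X hX1 hX2
        refine (h₃' X).mpr fun i => ?_
        rw [mulVec_add, (h₁ X).mpr hX1 i, (h₂ X).mpr hX2 i, add_zero]
      obtain ⟨s, hs⟩ := exists_eq_smul_of_col_inter_row_subset_col hn hm hv hsub
      have hs0 : s ≠ 0 := by rintro rfl; exact hu' (by rw [hs, zero_smul])
      obtain ⟨r, hr⟩ := exists_eq_smul_of_col_subset_col hn hm hv' (u := v' + v'') fun Y hY => by
        have e1 : ∀ i, γ.symm Y i *ᵥ v = 0 :=
          (h₁ (γ.symm Y)).mp (by simpa only [LinearEquiv.apply_symm_apply] using hY)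
        have e2 := (h₃' (γ.symm Y)).mp ((col_iff_col_of_eq_smul hs0 hs _).mpr e1)
        simpa only [LinearEquiv.apply_symm_apply] using e2
      exact hdep (r - 1) (by rw [sub_smul, one_smul, ← hr, add_sub_cancel_left])
    · have h₃' : ∀ X : Tuple n m, (∀ i, w₃ ᵥ* X i = 0) ↔ ∀ i, γ X i *ᵥ (v' + v'') = 0 := by
        intro X
        have := h₃ (γ X)
        simp only [LinearEquiv.symm_apply_apply] at this
        exact this
      have hsub : ∀ X : Tuple n m, (∀ i, X i *ᵥ v = 0) → (∀ i, w ᵥ* X i = 0) →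
          ∀ i, w₃ ᵥ* X i = 0 := by
        intro X hX1 hX2
        refine (h₃' X).mpr fun i => ?_
        rw [mulVec_add, (h₁ X).mpr hX1 i, (h₂ X).mpr hX2 i, add_zero]
      obtain ⟨s, hs⟩ := exists_eq_smul_of_col_inter_row_subset_row hn hm hw hsub
      have hs0 : s ≠ 0 := by rintro rfl; exact hw₃ (by rw [hs, zero_smul])
      obtain ⟨r, hr⟩ := exists_eq_smul_of_col_subset_col hn hm hv'' (u := v' + v'') fun Y hY => by
        have e1 : ∀ i, w ᵥ* γ.symm Y i = 0 :=
          (h₂ (γ.symm Y)).mp (by simpa only [LinearEquiv.apply_symm_apply] using hY)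
        have e2 := (h₃' (γ.symm Y)).mp ((row_iff_row_of_eq_smul hs0 hs _).mpr e1)
        simpa only [LinearEquiv.apply_symm_apply] using e2
      by_cases hr1 : r - 1 = 0
      · exact hv' (by
          have : v' = (r - 1) • v'' := by rw [sub_smul, one_smul, ← hr, add_sub_cancel_right]
          rw [this, hr1, zero_smul])
      · exact hdep (r - 1)⁻¹ (by
          have : v' = (r - 1) • v'' := by rw [sub_smul, one_smul, ← hr, add_sub_cancel_right]
          rw [this, smul_smul, inv_mul_cancel₀ hr1, one_smul])

/-- Not both `γ(M_v) = M^{w'}` and `γ(M^w) = M^{w''}`: the transposed form of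
`not_colCol_rowCol`. [cite: MakamWigderson2021, Thm. 1.13 (proof, elementary route)] -/
theorem not_colRow_rowRow (hn : 2 ≤ n) (hm : 1 ≤ m) (γ : Tuple n m ≃ₗ[ℂ] Tuple n m)
    {v w w' w'' : Fin n → ℂ} (hv : v ≠ 0) (hw : w ≠ 0) (hw' : w' ≠ 0) (hw'' : w'' ≠ 0)
    (h₁ : ∀ X : Tuple n m, (∀ i, w' ᵥ* γ X i = 0) ↔ ∀ i, X i *ᵥ v = 0)
    (h₂ : ∀ X : Tuple n m, (∀ i, w'' ᵥ* γ X i = 0) ↔ ∀ i, w ᵥ* X i = 0)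
    (hrow' : ∀ u : Fin n → ℂ, u ≠ 0 →
      (∃ u' : Fin n → ℂ, u' ≠ 0 ∧ ∀ X : Tuple n m, (∀ i, γ.symm X i *ᵥ u' = 0) ↔ ∀ i, u ᵥ* X i = 0) ∨
      (∃ w₃ : Fin n → ℂ, w₃ ≠ 0 ∧ ∀ X : Tuple n m, (∀ i, w₃ ᵥ* γ.symm X i = 0) ↔ ∀ i, u ᵥ* X i = 0)) :
    False := by
  obtain ⟨γt, hγt, hγts⟩ := exists_conj γ
  refine not_colCol_rowCol hn hm γt hw hv hw'' hw' (fun X => ?_) (fun X => ?_) fun u hu => ?_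
  · have e := h₂ fun j => (X j)ᵀ
    simp only [hγt, mulVec_transpose, vecMul_transpose] at e ⊢
    exact e
  · have e := h₁ fun j => (X j)ᵀ
    simp only [hγt, mulVec_transpose] at e ⊢
    exact e
  · rcases hrow' u hu with ⟨u', hu', h⟩ | ⟨w₃, hw₃, h⟩
    · right
      refine ⟨u', hu', fun X => ?_⟩
      have e := h fun j => (X j)ᵀ
      simp only [hγts, vecMul_transpose] at e ⊢
      exact e
    · left
      refine ⟨w₃, hw₃, fun X => ?_⟩
      have e := h fun j => (X j)ᵀ
      simp only [hγts, mulVec_transpose, vecMul_transpose] at e ⊢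
      exact e

/-- **Family separation.**  If `γ` and `γ⁻¹` map every `M_v` and every `M^w` onto a member of
`{M_{v'}} ∪ {M^{w'}}` (`n ≥ 2`, `m ≥ 1`), then `γ` either preserves both families or swaps them.
[cite: MakamWigderson2021, Thm. 1.13 (proof, elementary route)] -/
theorem families_preserved_or_swapped (hn : 2 ≤ n) (hm : 1 ≤ m) (γ : Tuple n m ≃ₗ[ℂ] Tuple n m)
    (hcol : ∀ v : Fin n → ℂ, v ≠ 0 →
      (∃ v' : Fin n → ℂ, v' ≠ 0 ∧ ∀ X : Tuple n m, (∀ i, γ X i *ᵥ v' = 0) ↔ ∀ i, X i *ᵥ v = 0) ∨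
      (∃ w' : Fin n → ℂ, w' ≠ 0 ∧ ∀ X : Tuple n m, (∀ i, w' ᵥ* γ X i = 0) ↔ ∀ i, X i *ᵥ v = 0))
    (hrow : ∀ w : Fin n → ℂ, w ≠ 0 →
      (∃ v' : Fin n → ℂ, v' ≠ 0 ∧ ∀ X : Tuple n m, (∀ i, γ X i *ᵥ v' = 0) ↔ ∀ i, w ᵥ* X i = 0) ∨
      (∃ w' : Fin n → ℂ, w' ≠ 0 ∧ ∀ X : Tuple n m, (∀ i, w' ᵥ* γ X i = 0) ↔ ∀ i, w ᵥ* X i = 0))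
    (hcol' : ∀ v : Fin n → ℂ, v ≠ 0 →
      (∃ v' : Fin n → ℂ, v' ≠ 0 ∧ ∀ X : Tuple n m, (∀ i, γ.symm X i *ᵥ v' = 0) ↔ ∀ i, X i *ᵥ v = 0) ∨
      (∃ w' : Fin n → ℂ, w' ≠ 0 ∧ ∀ X : Tuple n m, (∀ i, w' ᵥ* γ.symm X i = 0) ↔ ∀ i, X i *ᵥ v = 0))
    (hrow' : ∀ w : Fin n → ℂ, w ≠ 0 →
      (∃ v' : Fin n → ℂ, v' ≠ 0 ∧ ∀ X : Tuple n m, (∀ i, γ.symm X i *ᵥ v' = 0) ↔ ∀ i, w ᵥ* X i = 0) ∨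
      (∃ w' : Fin n → ℂ, w' ≠ 0 ∧ ∀ X : Tuple n m, (∀ i, w' ᵥ* γ.symm X i = 0) ↔ ∀ i, w ᵥ* X i = 0)) :
    ((∀ v : Fin n → ℂ, v ≠ 0 → ∃ v' : Fin n → ℂ, v' ≠ 0 ∧
        ∀ X : Tuple n m, (∀ i, γ X i *ᵥ v' = 0) ↔ ∀ i, X i *ᵥ v = 0) ∧
      ∀ w : Fin n → ℂ, w ≠ 0 → ∃ w' : Fin n → ℂ, w' ≠ 0 ∧
        ∀ X : Tuple n m, (∀ i, w' ᵥ* γ X i = 0) ↔ ∀ i, w ᵥ* X i = 0) ∨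
    ((∀ v : Fin n → ℂ, v ≠ 0 → ∃ w' : Fin n → ℂ, w' ≠ 0 ∧
        ∀ X : Tuple n m, (∀ i, w' ᵥ* γ X i = 0) ↔ ∀ i, X i *ᵥ v = 0) ∧
      ∀ w : Fin n → ℂ, w ≠ 0 → ∃ v' : Fin n → ℂ, v' ≠ 0 ∧
        ∀ X : Tuple n m, (∀ i, γ X i *ᵥ v' = 0) ↔ ∀ i, w ᵥ* X i = 0) := by
  have he : (Pi.single (⟨0, by omega⟩ : Fin n) (1 : ℂ) : Fin n → ℂ) ≠ 0 :=
    MarcusMoyls.single_one_ne_zero _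
  rcases hcol _ he with ⟨v₀', hv₀', h₀⟩ | ⟨w₀', hw₀', h₀⟩
  · left
    refine ⟨fun v hv => ?_, fun w hw => ?_⟩
    · rcases hcol v hv with h | ⟨w', hw', h⟩
      · exact h
      · exact (not_colCol_colRow hn hm γ he hv hv₀' hw' h₀ h hcol).elim
    · rcases hrow w hw with ⟨v', hv', h⟩ | h
      · exact (not_colCol_rowCol hn hm γ he hw hv₀' hv' h₀ h hcol').elim
      · exact h
  · right
    refine ⟨fun v hv => ?_, fun w hw => ?_⟩
    · rcases hcol v hv with ⟨v', hv', h⟩ | h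
      · exact (not_colCol_colRow hn hm γ hv he hv' hw₀' h h₀ hcol).elim
      · exact h
    · rcases hrow w hw with h | ⟨w', hw', h⟩
      · exact h
      · exact (not_colRow_rowRow hn hm γ he hw hw₀' hw' h₀ h hrow').elim

/-- If `γ` preserves the two families then so does `γ⁻¹`.
[cite: MakamWigderson2021, Thm. 1.13 (proof, elementary route)] -/
theorem symm_preserves (hn : 2 ≤ n) (hm : 1 ≤ m) (γ : Tuple n m ≃ₗ[ℂ] Tuple n m)
    (hA1 : ∀ v : Fin n → ℂ, v ≠ 0 → ∃ v' : Fin n → ℂ, v' ≠ 0 ∧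
      ∀ X : Tuple n m, (∀ i, γ X i *ᵥ v' = 0) ↔ ∀ i, X i *ᵥ v = 0)
    (hA2 : ∀ w : Fin n → ℂ, w ≠ 0 → ∃ w' : Fin n → ℂ, w' ≠ 0 ∧
      ∀ X : Tuple n m, (∀ i, w' ᵥ* γ X i = 0) ↔ ∀ i, w ᵥ* X i = 0)
    (hcol' : ∀ v : Fin n → ℂ, v ≠ 0 →
      (∃ v' : Fin n → ℂ, v' ≠ 0 ∧ ∀ X : Tuple n m, (∀ i, γ.symm X i *ᵥ v' = 0) ↔ ∀ i, X i *ᵥ v = 0) ∨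
      (∃ w' : Fin n → ℂ, w' ≠ 0 ∧ ∀ X : Tuple n m, (∀ i, w' ᵥ* γ.symm X i = 0) ↔ ∀ i, X i *ᵥ v = 0))
    (hrow' : ∀ w : Fin n → ℂ, w ≠ 0 →
      (∃ v' : Fin n → ℂ, v' ≠ 0 ∧ ∀ X : Tuple n m, (∀ i, γ.symm X i *ᵥ v' = 0) ↔ ∀ i, w ᵥ* X i = 0) ∨
      (∃ w' : Fin n → ℂ, w' ≠ 0 ∧ ∀ X : Tuple n m, (∀ i, w' ᵥ* γ.symm X i = 0) ↔ ∀ i, w ᵥ* X i = 0)) :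
    (∀ v : Fin n → ℂ, v ≠ 0 → ∃ v' : Fin n → ℂ, v' ≠ 0 ∧
        ∀ X : Tuple n m, (∀ i, γ.symm X i *ᵥ v' = 0) ↔ ∀ i, X i *ᵥ v = 0) ∧
      ∀ w : Fin n → ℂ, w ≠ 0 → ∃ w' : Fin n → ℂ, w' ≠ 0 ∧
        ∀ X : Tuple n m, (∀ i, w' ᵥ* γ.symm X i = 0) ↔ ∀ i, w ᵥ* X i = 0 := by
  refine ⟨fun v hv => ?_, fun w hw => ?_⟩
  · rcases hcol' v hv with h | ⟨w', hw', h⟩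
    · exact h
    · obtain ⟨w'', hw'', h2⟩ := hA2 w' hw'
      refine (not_col_iff_row hn hm hw'' (v := v) fun Y => ?_).elim
      have e1 := h Y
      have e2 := h2 (γ.symm Y)
      simp only [LinearEquiv.apply_symm_apply] at e2
      exact e1.symm.trans e2.symm
  · rcases hrow' w hw with ⟨v', hv', h⟩ | h
    · obtain ⟨v'', hv'', h2⟩ := hA1 v' hv'
      refine (not_col_iff_row hn hm hw (v := v'') fun Y => ?_).elim
      have e1 := h Y
      have e2 := h2 (γ.symm Y)
      simp only [LinearEquiv.apply_symm_apply] at e2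
      exact e2.trans e1
    · exact h

/-- If `γ` swaps the two families then so does `γ⁻¹`.
[cite: MakamWigderson2021, Thm. 1.13 (proof, elementary route)] -/
theorem symm_swaps (hn : 2 ≤ n) (hm : 1 ≤ m) (γ : Tuple n m ≃ₗ[ℂ] Tuple n m)
    (hB1 : ∀ v : Fin n → ℂ, v ≠ 0 → ∃ w' : Fin n → ℂ, w' ≠ 0 ∧
      ∀ X : Tuple n m, (∀ i, w' ᵥ* γ X i = 0) ↔ ∀ i, X i *ᵥ v = 0)
    (hB2 : ∀ w : Fin n → ℂ, w ≠ 0 → ∃ v' : Fin n → ℂ, v' ≠ 0 ∧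
      ∀ X : Tuple n m, (∀ i, γ X i *ᵥ v' = 0) ↔ ∀ i, w ᵥ* X i = 0)
    (hcol' : ∀ v : Fin n → ℂ, v ≠ 0 →
      (∃ v' : Fin n → ℂ, v' ≠ 0 ∧ ∀ X : Tuple n m, (∀ i, γ.symm X i *ᵥ v' = 0) ↔ ∀ i, X i *ᵥ v = 0) ∨
      (∃ w' : Fin n → ℂ, w' ≠ 0 ∧ ∀ X : Tuple n m, (∀ i, w' ᵥ* γ.symm X i = 0) ↔ ∀ i, X i *ᵥ v = 0))
    (hrow' : ∀ w : Fin n → ℂ, w ≠ 0 →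
      (∃ v' : Fin n → ℂ, v' ≠ 0 ∧ ∀ X : Tuple n m, (∀ i, γ.symm X i *ᵥ v' = 0) ↔ ∀ i, w ᵥ* X i = 0) ∨
      (∃ w' : Fin n → ℂ, w' ≠ 0 ∧ ∀ X : Tuple n m, (∀ i, w' ᵥ* γ.symm X i = 0) ↔ ∀ i, w ᵥ* X i = 0)) :
    (∀ v : Fin n → ℂ, v ≠ 0 → ∃ w' : Fin n → ℂ, w' ≠ 0 ∧
        ∀ X : Tuple n m, (∀ i, w' ᵥ* γ.symm X i = 0) ↔ ∀ i, X i *ᵥ v = 0) ∧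
      ∀ w : Fin n → ℂ, w ≠ 0 → ∃ v' : Fin n → ℂ, v' ≠ 0 ∧
        ∀ X : Tuple n m, (∀ i, γ.symm X i *ᵥ v' = 0) ↔ ∀ i, w ᵥ* X i = 0 := by
  refine ⟨fun v hv => ?_, fun w hw => ?_⟩
  · rcases hcol' v hv with ⟨v', hv', h⟩ | h
    · obtain ⟨w', hw', h2⟩ := hB1 v' hv'
      refine (not_col_iff_row hn hm hw' (v := v) fun Y => ?_).elim
      have e1 := h Y
      have e2 := h2 (γ.symm Y)
      simp only [LinearEquiv.apply_symm_apply] at e2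
      exact e1.symm.trans e2.symm
    · exact h
  · rcases hrow' w hw with h | ⟨w', hw', h⟩
    · exact h
    · obtain ⟨v', hv', h2⟩ := hB2 w' hw'
      refine (not_col_iff_row hn hm hw (v := v') fun Y => ?_).elim
      have e1 := h Y
      have e2 := h2 (γ.symm Y)
      simp only [LinearEquiv.apply_symm_apply] at e2
      exact e2.trans e1

/-- The twist `γ ∘ τ` of a linear automorphism `γ` of `Mat_n^m`.
[cite: MakamWigderson2021, Thm. 1.13 (proof, elementary route)] -/
theorem exists_twist (γ : Tuple n m ≃ₗ[ℂ] Tuple n m) :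
    ∃ γ₂ : Tuple n m ≃ₗ[ℂ] Tuple n m, (∀ X i, γ₂ X i = γ (fun j => (X j)ᵀ) i) ∧
      ∀ X i, γ₂.symm X i = (γ.symm X i)ᵀ := by
  let τe : Tuple n m ≃ₗ[ℂ] Tuple n m :=
    LinearEquiv.ofInvolutive (transposeMap n m) fun X => funext fun i => transpose_transpose (X i)
  exact ⟨τe.trans γ, fun X i => rfl, fun X i => rfl⟩

end KernelFamily

open KernelFamily in
/-- **Kernel-family preservers lie in `G_{n,m} ∪ G_{n,m}·τ`** (the preserver core of MW Thms. 1.13 /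
1.14, membership form without bookkeeping definitions).  Let `n ≥ 2`, `m ≥ 1`, and let
`g ∈ GL(Mat_n^m)` be such that `g` and `g⁻¹` map every `M_v = {X | Xᵢ v = 0 ∀ i}` (`v ≠ 0`) and
every `M^w = {X | wᵀ Xᵢ = 0 ∀ i}` (`w ≠ 0`) onto some `M_{v'}` or some `M^{w'}`.  Then
`g ∈ G_{n,m}` or `g·τ ∈ G_{n,m}`. [cite: MakamWigderson2021, Thm. 1.13 (proof, elementary route)] -/
theorem mem_G_or_mul_tau_mem_G_of_kernelSpaces {n m : ℕ} (hn : 2 ≤ n) (hm : 1 ≤ m)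
    (g : LinearMap.GeneralLinearGroup ℂ (Tuple n m))
    (hcol : ∀ v : Fin n → ℂ, v ≠ 0 →
      (∃ v' : Fin n → ℂ, v' ≠ 0 ∧ ∀ X : Tuple n m,
        (∀ i, (g : Tuple n m →ₗ[ℂ] Tuple n m) X i *ᵥ v' = 0) ↔ ∀ i, X i *ᵥ v = 0) ∨
      (∃ w' : Fin n → ℂ, w' ≠ 0 ∧ ∀ X : Tuple n m,
        (∀ i, w' ᵥ* (g : Tuple n m →ₗ[ℂ] Tuple n m) X i = 0) ↔ ∀ i, X i *ᵥ v = 0))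
    (hrow : ∀ w : Fin n → ℂ, w ≠ 0 →
      (∃ v' : Fin n → ℂ, v' ≠ 0 ∧ ∀ X : Tuple n m,
        (∀ i, (g : Tuple n m →ₗ[ℂ] Tuple n m) X i *ᵥ v' = 0) ↔ ∀ i, w ᵥ* X i = 0) ∨
      (∃ w' : Fin n → ℂ, w' ≠ 0 ∧ ∀ X : Tuple n m,
        (∀ i, w' ᵥ* (g : Tuple n m →ₗ[ℂ] Tuple n m) X i = 0) ↔ ∀ i, w ᵥ* X i = 0))
    (hcol' : ∀ v : Fin n → ℂ, v ≠ 0 →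
      (∃ v' : Fin n → ℂ, v' ≠ 0 ∧ ∀ X : Tuple n m,
        (∀ i, ((g⁻¹ : LinearMap.GeneralLinearGroup ℂ (Tuple n m)) : Tuple n m →ₗ[ℂ] Tuple n m)
          X i *ᵥ v' = 0) ↔ ∀ i, X i *ᵥ v = 0) ∨
      (∃ w' : Fin n → ℂ, w' ≠ 0 ∧ ∀ X : Tuple n m,
        (∀ i, w' ᵥ* ((g⁻¹ : LinearMap.GeneralLinearGroup ℂ (Tuple n m)) :
          Tuple n m →ₗ[ℂ] Tuple n m) X i = 0) ↔ ∀ i, X i *ᵥ v = 0))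
    (hrow' : ∀ w : Fin n → ℂ, w ≠ 0 →
      (∃ v' : Fin n → ℂ, v' ≠ 0 ∧ ∀ X : Tuple n m,
        (∀ i, ((g⁻¹ : LinearMap.GeneralLinearGroup ℂ (Tuple n m)) : Tuple n m →ₗ[ℂ] Tuple n m)
          X i *ᵥ v' = 0) ↔ ∀ i, w ᵥ* X i = 0) ∨
      (∃ w' : Fin n → ℂ, w' ≠ 0 ∧ ∀ X : Tuple n m,
        (∀ i, w' ᵥ* ((g⁻¹ : LinearMap.GeneralLinearGroup ℂ (Tuple n m)) :
          Tuple n m →ₗ[ℂ] Tuple n m) X i = 0) ↔ ∀ i, w ᵥ* X i = 0)) :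
    g ∈ G n m ∨ g * tau n m ∈ G n m := by
  let γ : Tuple n m ≃ₗ[ℂ] Tuple n m := LinearMap.GeneralLinearGroup.toLinearEquiv g
  have hγ : ∀ X, γ X = (g : Tuple n m →ₗ[ℂ] Tuple n m) X := fun X => rfl
  have hγ' : ∀ X, γ.symm X =
      ((g⁻¹ : LinearMap.GeneralLinearGroup ℂ (Tuple n m)) : Tuple n m →ₗ[ℂ] Tuple n m) X :=
    fun X => rfl
  -- how a sandwich formula gives membership
  have key : ∀ (P : Matrix (Fin m) (Fin m) ℂ) (U V : Matrix (Fin n) (Fin n) ℂ),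
      IsUnit P → IsUnit U → IsUnit V → ∀ g' : LinearMap.GeneralLinearGroup ℂ (Tuple n m),
      (∀ X, (g' : Tuple n m →ₗ[ℂ] Tuple n m) X = tripleAct P U Vᵀ X) → g' ∈ G n m := by
    intro P U V hP hU hV g' hg'
    rw [mem_G_iff]
    refine ⟨hP.unit, hU.unit, hV.unit⁻¹, LinearMap.ext fun X => ?_⟩
    rw [hg' X, inv_inv, IsUnit.unit_spec, IsUnit.unit_spec, IsUnit.unit_spec]
  have hmul : ∀ X, ((g * tau n m : LinearMap.GeneralLinearGroup ℂ (Tuple n m)) :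
      Tuple n m →ₗ[ℂ] Tuple n m) X = (g : Tuple n m →ₗ[ℂ] Tuple n m) (transposeMap n m X) :=
    fun X => rfl
  have hττ : ∀ X : Tuple n m, transposeMap n m (transposeMap n m X) = X :=
    fun X => funext fun i => transpose_transpose (X i)
  rcases families_preserved_or_swapped hn hm γ hcol hrow hcol' hrow' with ⟨hA1, hA2⟩ | ⟨hB1, hB2⟩
  · obtain ⟨hA1', hA2'⟩ := symm_preserves hn hm γ hA1 hA2 hcol' hrow'
    obtain ⟨P, U, V, hP, hU, hV, hPUV⟩ :=
      exists_eq_tripleAct_of_kernelFamilies hn hm γ hA1 hA2 hA1' hA2'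
    rcases hPUV with h | h
    · exact Or.inl (key P U V hP hU hV g fun X => h X)
    · refine Or.inr (key P U V hP hU hV _ fun X => ?_)
      rw [hmul, ← hγ, h, hττ]
  · obtain ⟨hB1', hB2'⟩ := symm_swaps hn hm γ hB1 hB2 hcol' hrow'
    obtain ⟨γ₂, hγ₂, hγ₂'⟩ := exists_twist γ
    have hc2 : ∀ v : Fin n → ℂ, v ≠ 0 → ∃ v' : Fin n → ℂ, v' ≠ 0 ∧
        ∀ X : Tuple n m, (∀ i, γ₂ X i *ᵥ v' = 0) ↔ ∀ i, X i *ᵥ v = 0 := by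
      intro v hv
      obtain ⟨v', hv', h⟩ := hB2 v hv
      refine ⟨v', hv', fun X => ?_⟩
      have e := h fun j => (X j)ᵀ
      simp only [hγ₂, vecMul_transpose] at e ⊢
      exact e
    have hr2 : ∀ w : Fin n → ℂ, w ≠ 0 → ∃ w' : Fin n → ℂ, w' ≠ 0 ∧
        ∀ X : Tuple n m, (∀ i, w' ᵥ* γ₂ X i = 0) ↔ ∀ i, w ᵥ* X i = 0 := by
      intro w hw
      obtain ⟨w', hw', h⟩ := hB1 w hw
      refine ⟨w', hw', fun X => ?_⟩
      have e := h fun j => (X j)ᵀ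
      simp only [hγ₂, mulVec_transpose] at e ⊢
      exact e
    have hc2' : ∀ v : Fin n → ℂ, v ≠ 0 → ∃ v' : Fin n → ℂ, v' ≠ 0 ∧
        ∀ X : Tuple n m, (∀ i, γ₂.symm X i *ᵥ v' = 0) ↔ ∀ i, X i *ᵥ v = 0 := by
      intro v hv
      obtain ⟨w', hw', h⟩ := hB1' v hv
      refine ⟨w', hw', fun X => ?_⟩
      simp only [hγ₂', mulVec_transpose]
      exact h X
    have hr2' : ∀ w : Fin n → ℂ, w ≠ 0 → ∃ w' : Fin n → ℂ, w' ≠ 0 ∧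
        ∀ X : Tuple n m, (∀ i, w' ᵥ* γ₂.symm X i = 0) ↔ ∀ i, w ᵥ* X i = 0 := by
      intro w hw
      obtain ⟨v', hv', h⟩ := hB2' w hw
      refine ⟨v', hv', fun X => ?_⟩
      simp only [hγ₂', vecMul_transpose]
      exact h X
    obtain ⟨P, U, V, hP, hU, hV, hPUV⟩ :=
      exists_eq_tripleAct_of_kernelFamilies hn hm γ₂ hc2 hr2 hc2' hr2'
    have hγ₂g : ∀ X, γ₂ X = (g : Tuple n m →ₗ[ℂ] Tuple n m) (transposeMap n m X) :=
      fun X => funext fun i => hγ₂ X i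
    rcases hPUV with h | h
    · refine Or.inr (key P U V hP hU hV _ fun X => ?_)
      rw [hmul, ← hγ₂g, h]
    · refine Or.inl (key P U V hP hU hV g fun X => ?_)
      have e := h (transposeMap n m X)
      rw [hγ₂g, hττ] at e
      exact e

/-- **Kernel-family preservers lie in `G_{n,m} ∪ G_{n,m}·τ`**, stated with the tree's bookkeeping
submodules `tupleOf (kerMat v) = ℂ^m ⊗ K_v` and `tupleOf (cokerMat w) = ℂ^m ⊗ K^w`
(`MW21SingMaximalSubspaces`): if `g` and `g⁻¹` map each of these onto one of these (`n ≥ 2`,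
`m ≥ 1`), then `g ∈ G_{n,m}` or `g·τ ∈ G_{n,m}`.  This is the shape produced, for `g ∈ 𝒢_{SING}` /
`𝒢_{NSING}`, by the classification of the `m·n(n-1)`-dimensional linear subspaces of `SING_{n,m}` /
`NSING_{n,m}` (`exists_eq_tupleOf_of_finrank_eq`). [cite: MakamWigderson2021, Thm. 1.13 (proof, elementary route)] -/
theorem mem_G_or_mul_tau_mem_G_of_map_tupleOf {n m : ℕ} (hn : 2 ≤ n) (hm : 1 ≤ m)
    (g : LinearMap.GeneralLinearGroup ℂ (Tuple n m))
    (hK : ∀ v : Fin n → ℂ, v ≠ 0 →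
      (∃ v' : Fin n → ℂ, v' ≠ 0 ∧
        (tupleOf (kerMat v)).map (g : Tuple n m →ₗ[ℂ] Tuple n m) = tupleOf (kerMat v')) ∨
      (∃ w' : Fin n → ℂ, w' ≠ 0 ∧
        (tupleOf (kerMat v)).map (g : Tuple n m →ₗ[ℂ] Tuple n m) = tupleOf (cokerMat w')))
    (hC : ∀ w : Fin n → ℂ, w ≠ 0 →
      (∃ v' : Fin n → ℂ, v' ≠ 0 ∧
        (tupleOf (cokerMat w)).map (g : Tuple n m →ₗ[ℂ] Tuple n m) = tupleOf (kerMat v')) ∨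
      (∃ w' : Fin n → ℂ, w' ≠ 0 ∧
        (tupleOf (cokerMat w)).map (g : Tuple n m →ₗ[ℂ] Tuple n m) = tupleOf (cokerMat w')))
    (hK' : ∀ v : Fin n → ℂ, v ≠ 0 →
      (∃ v' : Fin n → ℂ, v' ≠ 0 ∧ (tupleOf (kerMat v)).map
        ((g⁻¹ : LinearMap.GeneralLinearGroup ℂ (Tuple n m)) : Tuple n m →ₗ[ℂ] Tuple n m) =
          tupleOf (kerMat v')) ∨
      (∃ w' : Fin n → ℂ, w' ≠ 0 ∧ (tupleOf (kerMat v)).map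
        ((g⁻¹ : LinearMap.GeneralLinearGroup ℂ (Tuple n m)) : Tuple n m →ₗ[ℂ] Tuple n m) =
          tupleOf (cokerMat w')))
    (hC' : ∀ w : Fin n → ℂ, w ≠ 0 →
      (∃ v' : Fin n → ℂ, v' ≠ 0 ∧ (tupleOf (cokerMat w)).map
        ((g⁻¹ : LinearMap.GeneralLinearGroup ℂ (Tuple n m)) : Tuple n m →ₗ[ℂ] Tuple n m) =
          tupleOf (kerMat v')) ∨
      (∃ w' : Fin n → ℂ, w' ≠ 0 ∧ (tupleOf (cokerMat w)).map
        ((g⁻¹ : LinearMap.GeneralLinearGroup ℂ (Tuple n m)) : Tuple n m →ₗ[ℂ] Tuple n m) =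
          tupleOf (cokerMat w'))) :
    g ∈ G n m ∨ g * tau n m ∈ G n m := by
  -- membership transport along an injective linear map
  have conv : ∀ (f : Tuple n m →ₗ[ℂ] Tuple n m), Function.Injective f →
      ∀ (A B : Submodule ℂ (Tuple n m)), A.map f = B → ∀ X, f X ∈ B ↔ X ∈ A := by
    intro f hf A B hAB X
    rw [← hAB, Submodule.mem_map]
    constructor
    · rintro ⟨Y, hY, hYX⟩
      rwa [← hf hYX]
    · exact fun hX => ⟨X, hX, rfl⟩
  have hinj : Function.Injective (g : Tuple n m →ₗ[ℂ] Tuple n m) :=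
    (LinearMap.GeneralLinearGroup.toLinearEquiv g).injective
  have hinj' : Function.Injective
      ((g⁻¹ : LinearMap.GeneralLinearGroup ℂ (Tuple n m)) : Tuple n m →ₗ[ℂ] Tuple n m) :=
    (LinearMap.GeneralLinearGroup.toLinearEquiv g⁻¹).injective
  have memK : ∀ (v : Fin n → ℂ) (X : Tuple n m), X ∈ tupleOf (m := m) (kerMat v) ↔
      ∀ i, X i *ᵥ v = 0 := fun v X => Iff.rfl
  have memC : ∀ (w : Fin n → ℂ) (X : Tuple n m), X ∈ tupleOf (m := m) (cokerMat w) ↔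
      ∀ i, w ᵥ* X i = 0 := fun w X => Iff.rfl
  refine mem_G_or_mul_tau_mem_G_of_kernelSpaces hn hm g (fun v hv => ?_) (fun w hw => ?_)
    (fun v hv => ?_) (fun w hw => ?_)
  · rcases hK v hv with ⟨v', hv', h⟩ | ⟨w', hw', h⟩
    · exact Or.inl ⟨v', hv', fun X => by
        rw [← memK, ← memK]; exact conv _ hinj _ _ h X⟩
    · exact Or.inr ⟨w', hw', fun X => by
        rw [← memC, ← memK]; exact conv _ hinj _ _ h X⟩
  · rcases hC w hw with ⟨v', hv', h⟩ | ⟨w', hw', h⟩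
    · exact Or.inl ⟨v', hv', fun X => by
        rw [← memK, ← memC]; exact conv _ hinj _ _ h X⟩
    · exact Or.inr ⟨w', hw', fun X => by
        rw [← memC, ← memC]; exact conv _ hinj _ _ h X⟩
  · rcases hK' v hv with ⟨v', hv', h⟩ | ⟨w', hw', h⟩
    · exact Or.inl ⟨v', hv', fun X => by
        rw [← memK, ← memK]; exact conv _ hinj' _ _ h X⟩
    · exact Or.inr ⟨w', hw', fun X => by
        rw [← memC, ← memK]; exact conv _ hinj' _ _ h X⟩
  · rcases hC' w hw with ⟨v', hv', h⟩ | ⟨w', hw', h⟩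
    · exact Or.inl ⟨v', hv', fun X => by
        rw [← memK, ← memC]; exact conv _ hinj' _ _ h X⟩
    · exact Or.inr ⟨w', hw', fun X => by
        rw [← memC, ← memC]; exact conv _ hinj' _ _ h X⟩

end MakamWigderson

end Literature.Computability.AlgebraicComplexity

end
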